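import Mathlib
import HarnessLib
import Literature.NumberTheory.LFunctions.CriticalLineTwoThirdsMatrixProofs

/-!
# RH-FREE — «nothing here bears on the truth of RH»: Alpöge–Furman 2026 (arXiv:2608.13637), Proposition 4.2 (`tr G̃ = N(I′) + O(√X L²)`) — PROVED

This file DISCHARGES the tree's claim `Literature.NumberTheory.LFunctions.AlpogeFurman2026_trace`
(module `CriticalLineTwoThirdsMatrix`): `theorem AlpogeFurman2026_trace_holds : AlpogeFurman2026_trace`
— for every window `ψ` (`IsWindow ψ`) there are `C, T₀` with `‖tr G̃_ψ(T) − N(I′)‖ ≤ C √T L²` for all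
`T ≥ T₀` (`L = log(T/2π)`), for the CONCRETE compressed form `gramMatrix ψ T` and window count
`nearZeroCount T` of [AF26] §§2.2–2.3 as typed there. No new definition, no new claim; users'
`(h : AlpogeFurman2026_trace)` are now fed `AlpogeFurman2026_trace_holds`.

STATUS NOTE (no endorsement). Proposition 4.2 is an unconditional statement about the finitely many
zeros of `ζ` with ordinates in a window and the Fourier transform of a compactly supported bump; it
neither uses nor bears on RH, and its formal proof here says nothing about [AF26]'s MAIN results:
Theorem A (`≥ ⅔` of the zeros simple and on the line) needs in addition Theorem 5.7
(`AlpogeFurman2026_hilbertSchmidt`, the pair-correlation / Hilbert–Schmidt computation), which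
remains a CLAIM of an unrefereed preprint (`[claim: AlpogeFurman2026, status: under-review]`); see
`CriticalLineTwoThirdsMatrixProofs` for "Theorem A from the two claims" and `CriticalLineTwoThirds`
for the source's own caveats.

## The printed proof and this formalisation

[AF26] Proposition 4.2 (p. 6): "`tr(v_ρ v_ρᵀ) = Σ_{0≤k<d} φ̂(γ_ρ − α_k)²`; by the decay (2.9)
`|φ̂(z)| ≪ e^{L|Im z|/2} min(1, ‖L Re z‖^{-100})` and Lemma 2.1 (`Σ_{k∈ℤ} |φ̂(x − α_k)|² = aL²`
identically), each zero contributes `aL²(1 + O(tail))`, the tails summing to `O(√X L²)` against the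
density `≪ L` of zeros (`N(t+1) − N(t) ≪ log t`); zeros off the line have `|Im γ_ρ| ≤ ½`, costing the
factor `e^{L/2} = √(X/2π)`." We follow this architecture, with `M := L∫φ_T² = aL²` (`gramWeight = M⁻¹`,
`gramWeight_eq_inv`) and `E_ρ := Σ_{0≤k<d} φ̂(γ_ρ − α_k)² − M`, so that
`tr G̃ − N(I′) = M⁻¹ Σ_ρ m_ρ E_ρ` (`trace_gramMatrix_eq`):
* §1 generic Fourier lemmas — the frequency shift `φ̂(ξ + iy) = (φ e^{y·})^(ξ)`, the translation
  trick `ĝ(ξ) = ½ ∫ (g(u) − g(u − π/ξ)) e^{−iξu} du`, and arithmetic-progression sums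
  `Σ_k 1/(D + kh)² ≤ 1/D² + 1/(hD)`. DEVIATION: the paper's (2.9) is proved by 100-fold integration by
  parts for a `C^∞` bump; one power of decay, `|φ̂(ξ + iy)| ≤ C_d e^{L|y|/2}/|ξ|` (`norm_hat_phi_le`),
  suffices for Proposition 4.2 and needs only LIPSCHITZ data of the clamped window `φ_T` of the typed
  model (`phi`, built from Mathlib's `C¹` ramp `Real.smoothTransition` and `√ψ ∘ clampHalf`), which is
  why the translation trick replaces differentiation;
* §2 regularity constants: a Lipschitz constant of the ramp (`exists_lipschitz_smoothRamp`), and the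
  floor `m₀ > 0`, a bound `B` and a Lipschitz constant `K` of `√ψ` on `[−½, ½]` (`IsWindow.exists_bounds`,
  from `C²` on the compact interval and positivity);
* §3 the `L¹` modulus of continuity of `φ_T e^{y·}` (`integral_norm_shift_sub_le`; the ramps are
  localised to two intervals of length `≤ 1 + δ` so that no factor `L` is lost) and the decay estimate;
* §4 Gabor at a complex point, from the tree's PROVED Lemma 2.1 (`hasSum_hat_mul_hat`,
  `GaborCriticalDensityPoisson`): `Σ_{k∈ℤ} |φ̂(z − α_k)|² = L ∫ φ_T² e^{2(Im z)u} ≤ e^{L|Im z|} M` and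
  `Σ_{k∈ℤ} φ̂(z − α_k)² = M`;
* §5 per-zero bounds: `|E_ρ| ≤ (e^{L|y|} + 1) M` always (near zeros), and for a zero at distance
  `D ≥ 2` (resp. `≥ 1`) from the endpoints the tail of the Gabor sum outside `0 ≤ k < d` is
  `≤ C_d² e^{L|y|} (5/D² + 3/(hD))` inside `(T, 2T]`, resp. `≤ C_d² e^{L|y|}(1/D² + 1/(hD)) + M`
  outside (`h = 2π/L` the grid step, `d h ∈ (T − h, T]`);
* §6 zero bookkeeping: `N(t+2) − N(t) ≤ 30 L` for `2π ≤ t ≤ 4T − 2` from the tree's explicit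
  Riemann–von Mangoldt formula (`zetaZeroCount_window_le_nine`), `M ≥ m₀L²/2` (`normalisation_ge`),
  and the trace formula;
* §7 the zero sums: near zeros (`D_ρ < 2`) have mass `≤ 120 L`; far zeros satisfy
  `Σ m_ρ/D_ρ ≤ 180 L²` (layers `⌊D_ρ⌋ = j`, four length-2 windows each, against the harmonic sum
  `Σ_{j≤2T} 1/j ≤ 1 + log 2T`, Mathlib's `harmonic_le_one_add_log`); the zeros of `I′` outside `(T,2T]`
  have mass `≤ 150 √T L` (`nearZeroCount_sub_window_le`);
* §8 assembly with `e^{L|y|} ≤ e^{L/2} ≤ √T`: `‖tr G̃ − N(I′)‖ ≤ (390 + 360 C_d²/m₀) √T L ≤ C √T L²`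
  for `T ≥ max(300, 2π e^{10})`.
All constants are explicit but not optimised; the window `I′ = [T − √T, 2T + √T)` and the weights
`m_ρ` are those of the typed model (`nearZeros`, `gramMatrix`).
* §9 records the consequence for the §6 assembly of `CriticalLineTwoThirdsMatrixProofs`: in the typed
  model Theorem A (both parts, every window; (1.3), (1.4); the cumulative form) now follows from
  Theorem 5.7 ALONE (`AlpogeFurman2026_thmA_*_of_HS`, `…_dyadic_of_HS`) — the claim
  `AlpogeFurman2026_hilbertSchmidt` is the single remaining analytic input, and remains a CLAIM.
* §10 does the same for Remark 6.1 (the rate): the §6 chain with the typed error terms of the two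
  claims gives `N₀ˢ(T,2T) ≥ (2 − R(ψ) − c log log T/log T) N(T,2T)` for `T ≥ T₀`, every window
  (`AlpogeFurman2026_rate_of_trace_HS`), whence `AlpogeFurman2026_simple_critical_rate_of_HS :
  AlpogeFurman2026_hilbertSchmidt → AlpogeFurman2026_simple_critical_rate` — every `ζ`-claim of
  `CriticalLineTwoThirds` is now a consequence of Theorem 5.7 alone in the typed model.

## References
* [AlpogeFurman2026] L. Alpöge, T. Furman, *At least two thirds of the zeros of the Riemann zeta
  function are simple and on the critical line*, arXiv:2608.13637 (2026), §§2.2–2.3, Lemma 2.1,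
  eq. (2.9)–(2.11), Proposition 4.2 (p. 6). Unrefereed preprint.
* Mathlib: `Real.smoothTransition`, `VectorFourier`/Fourier series on `AddCircle` (via the tree's
  `GaborCriticalDensityPoisson`), `harmonic_le_one_add_log`.
-/

noncomputable section

open Complex Filter Set MeasureTheory Matrix
open scoped Real Topology ComplexConjugate

namespace Literature.NumberTheory.LFunctions

namespace AlpogeFurman2026

variable {ψ : ℝ → ℝ}

/-! ## §1. Three generic lemmas: frequency shift, the translation trick, arithmetic-progression sums -/

/-- Moving the frequency off the real axis reweights the window exponentially:
`φ̂(ξ + iy) = (φ · e^{y·})^(ξ)` for real `ξ, y`. [cite: AlpogeFurman2026, eq. (2.9) (p. 4: "`|φ̂(z)| ≪ e^{L|Im z|/2} …`")] -/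
theorem hat_ofReal_add_mul_I (φ : ℝ → ℝ) (ξ y : ℝ) :
    hat (fun u ↦ (φ u : ℂ)) ((ξ : ℂ) + (y : ℂ) * I) =
      hat (fun u ↦ ((φ u * Real.exp (y * u) : ℝ) : ℂ)) ξ := by
  simp only [hat]
  refine integral_congr_ae (Eventually.of_forall fun u ↦ ?_)
  have h : -(I * ((ξ : ℂ) + (y : ℂ) * I) * u) = ((y * u : ℝ) : ℂ) + -(I * ξ * u) := by
    have hI : I * I = -1 := Complex.I_mul_I
    push_cast
    linear_combination (-(y : ℂ) * u) * hI
  dsimp only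
  rw [h, Complex.exp_add, ← Complex.ofReal_exp]
  push_cast
  ring

/-- **The translation trick** (Riemann–Lebesgue): for integrable `g` and real `ξ ≠ 0`,
`ĝ(ξ) = ½ ∫ (g(u) − g(u − π/ξ)) e^{−iξu} du` (substitute `u ↦ u − π/ξ`, `e^{−iπ} = −1`).
[cite: AlpogeFurman2026, eq. (2.9) (p. 4)] -/
theorem hat_eq_half_integral_sub_shift {g : ℝ → ℂ} (hg : Integrable g) {ξ : ℝ} (hξ : ξ ≠ 0) :
    hat g ξ = (1 / 2 : ℂ) * ∫ u : ℝ, (g u - g (u - π / ξ)) * cexp (-(I * ξ * u)) := by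
  have hξC : (ξ : ℂ) ≠ 0 := by exact_mod_cast hξ
  have hshift : ∫ u : ℝ, g (u - π / ξ) * cexp (-(I * ξ * u)) = -hat g ξ := by
    have h := integral_sub_right_eq_self (μ := volume)
      (fun u : ℝ ↦ g u * cexp (-(I * ξ * ((u + π / ξ : ℝ) : ℂ)))) (π / ξ)
    simp only [sub_add_cancel] at h
    rw [h, hat, ← integral_neg]
    refine integral_congr_ae (Eventually.of_forall fun u ↦ ?_)
    have hexp : cexp (-(I * ξ * ((u + π / ξ : ℝ) : ℂ))) = -cexp (-(I * ξ * u)) := by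
      have e : -(I * ξ * ((u + π / ξ : ℝ) : ℂ)) = -(I * ξ * u) + -(π * I) := by
        push_cast
        field_simp
        ring
      rw [e, Complex.exp_add, Complex.exp_neg (π * I), Complex.exp_pi_mul_I]
      ring
    dsimp only
    rw [hexp]
    ring
  have hm : AEStronglyMeasurable (fun u : ℝ ↦ cexp (-(I * ξ * u))) volume :=
    (by fun_prop : Continuous fun u : ℝ ↦ cexp (-(I * ξ * u))).aestronglyMeasurable
  have hb : ∀ᵐ u : ℝ, ‖cexp (-(I * ξ * u))‖ ≤ 1 :=
    Eventually.of_forall fun u ↦ by rw [Complex.norm_exp]; simp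
  have hi1 : Integrable fun u : ℝ ↦ g u * cexp (-(I * ξ * u)) := hg.mul_bdd hm hb
  have hi2 : Integrable fun u : ℝ ↦ g (u - π / ξ) * cexp (-(I * ξ * u)) :=
    (hg.comp_sub_right (π / ξ)).mul_bdd hm hb
  have hsplit : ∫ u : ℝ, (g u - g (u - π / ξ)) * cexp (-(I * ξ * u)) =
      (∫ u : ℝ, g u * cexp (-(I * ξ * u))) - ∫ u : ℝ, g (u - π / ξ) * cexp (-(I * ξ * u)) := by
    rw [← integral_sub hi1 hi2]
    refine integral_congr_ae (Eventually.of_forall fun u ↦ ?_)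
    ring
  rw [hsplit, hshift, hat]
  ring

/-- Hence `|ĝ(ξ)| ≤ ½ ∫ |g(u) − g(u − π/ξ)| du` (real `ξ ≠ 0`, `g` integrable).
[cite: AlpogeFurman2026, eq. (2.9) (p. 4)] -/
theorem norm_hat_le_half_integral_sub_shift {g : ℝ → ℂ} (hg : Integrable g) {ξ : ℝ} (hξ : ξ ≠ 0) :
    ‖hat g ξ‖ ≤ (1 / 2) * ∫ u : ℝ, ‖g u - g (u - π / ξ)‖ := by
  rw [hat_eq_half_integral_sub_shift hg hξ, norm_mul]
  have h1 : ‖(1 / 2 : ℂ)‖ = 1 / 2 := by simp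
  rw [h1]
  refine mul_le_mul_of_nonneg_left ?_ (by norm_num)
  refine (norm_integral_le_integral_norm _).trans (le_of_eq ?_)
  refine integral_congr_ae (Eventually.of_forall fun u ↦ ?_)
  dsimp only
  rw [norm_mul, Complex.norm_exp]
  simp

/-- Sums over an arithmetic progression by telescoping: for `D, h > 0`,
`Σ_{j<n} 1/(D + jh)² ≤ 1/D² + 1/(hD)` (since `1/(D+jh)² ≤ (1/h)(1/(D+(j−1)h) − 1/(D+jh))` for `j ≥ 1`).
This is the "integral comparison (step `h = 2π/L`)" of [AF26] Proposition 4.2's proof.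
[cite: AlpogeFurman2026, Proposition 4.2 (proof), p. 6] -/
theorem sum_inv_sq_arith_le {D h : ℝ} (hD : 0 < D) (hh : 0 < h) (n : ℕ) :
    ∑ j ∈ Finset.range n, 1 / (D + j * h) ^ 2 ≤ 1 / D ^ 2 + 1 / (h * D) := by
  rcases n with _ | m
  · simp only [Finset.range_zero, Finset.sum_empty]; positivity
  rw [Finset.sum_range_succ']
  simp only [Nat.cast_zero, zero_mul, add_zero, Nat.cast_succ]
  -- telescoping majorant for the terms `j + 1`
  have hterm : ∀ j : ℕ, 1 / (D + ((j : ℝ) + 1) * h) ^ 2 ≤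
      (1 / h) * (1 / (D + j * h) - 1 / (D + ((j : ℝ) + 1) * h)) := by
    intro j
    have h1 : 0 < D + j * h := by positivity
    have h2 : 0 < D + ((j : ℝ) + 1) * h := by positivity
    have e : (1 / h) * (1 / (D + j * h) - 1 / (D + ((j : ℝ) + 1) * h)) =
        1 / ((D + j * h) * (D + ((j : ℝ) + 1) * h)) := by
      field_simp
      ring
    rw [e, pow_two]
    exact one_div_le_one_div_of_le (mul_pos h1 h2) (mul_le_mul_of_nonneg_right (by linarith) h2.le)
  have hsum : ∑ j ∈ Finset.range m, 1 / (D + ((j : ℝ) + 1) * h) ^ 2 ≤ 1 / (h * D) := by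
    calc ∑ j ∈ Finset.range m, 1 / (D + ((j : ℝ) + 1) * h) ^ 2
        ≤ ∑ j ∈ Finset.range m, (1 / h) * (1 / (D + j * h) - 1 / (D + ((j : ℝ) + 1) * h)) :=
          Finset.sum_le_sum fun j _ ↦ hterm j
      _ = (1 / h) * (1 / D - 1 / (D + m * h)) := by
          rw [← Finset.mul_sum]
          congr 1
          induction m with
          | zero => simp
          | succ k ih =>
            rw [Finset.sum_range_succ, ih]
            push_cast
            ring
      _ ≤ (1 / h) * (1 / D) := by
          have : 0 ≤ 1 / (D + m * h) := by positivity
          exact mul_le_mul_of_nonneg_left (by linarith) (by positivity)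
      _ = 1 / (h * D) := by rw [one_div_mul_one_div]
  linarith


/-- `|e^t − 1| ≤ |t| e^{|t|}`. [folklore] -/
private theorem abs_exp_sub_one_le_mul (t : ℝ) : |Real.exp t - 1| ≤ |t| * Real.exp |t| := by
  rcases le_or_gt 0 t with ht | ht
  · rw [abs_of_nonneg ht, abs_of_nonneg (by linarith [Real.add_one_le_exp t])]
    -- `e^t − 1 ≤ t e^t` since `e^{-t} ≥ 1 − t`
    have h1 := Real.add_one_le_exp (-t)
    have h2 : Real.exp (-t) * Real.exp t = 1 := by rw [← Real.exp_add]; simp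
    nlinarith [Real.exp_pos t, Real.exp_pos (-t)]
  · rw [abs_of_neg ht, abs_of_nonpos (by linarith [Real.exp_lt_exp.2 ht, Real.exp_zero])]
    have h1 := Real.add_one_le_exp t
    have h3 : 1 ≤ Real.exp (-t) := Real.one_le_exp (by linarith)
    nlinarith [Real.exp_pos t]

/-- `|y| ∫_a^b e^{yu} du ≤ e^{|y| max(|a|,|b|)}`-type bound on a symmetric interval:
`|y| ∫_{−R}^{R} e^{yu} du ≤ e^{|y|R}` (`R ≥ 0`). [folklore] -/
private theorem abs_mul_integral_exp_le {y R : ℝ} (hR : 0 ≤ R) :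
    |y| * ∫ u in (-R)..R, Real.exp (y * u) ≤ Real.exp (|y| * R) := by
  rcases eq_or_ne y 0 with rfl | hy
  · simp
  · have hint : ∫ u in (-R)..R, Real.exp (y * u) = y⁻¹ * (Real.exp (y * R) - Real.exp (y * -R)) := by
      rw [intervalIntegral.integral_comp_mul_left (fun u ↦ Real.exp u) hy, integral_exp, smul_eq_mul]
    rw [hint, ← mul_assoc]
    have hyy : |y| * y⁻¹ = if 0 < y then 1 else -1 := by
      split_ifs with h
      · rw [abs_of_pos h, mul_inv_cancel₀ hy]
      · rw [abs_of_neg (lt_of_le_of_ne (not_lt.1 h) hy), neg_mul, mul_inv_cancel₀ hy]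
    rw [hyy]
    have e1 : Real.exp (y * R) ≤ Real.exp (|y| * R) :=
      Real.exp_le_exp.2 (mul_le_mul_of_nonneg_right (le_abs_self y) hR)
    have e2 : Real.exp (y * -R) ≤ Real.exp (|y| * R) := Real.exp_le_exp.2 (by
      have := neg_abs_le y; nlinarith)
    split_ifs <;> nlinarith [Real.exp_pos (y * R), Real.exp_pos (y * -R)]

/-! ## §2. Regularity constants of the ramp and of a window -/

/-- The ramp `χ` is Lipschitz (it is `C¹` and its derivative vanishes off `[0,1]`).
[cite: AlpogeFurman2026, §2.2 (p. 4: "`χ ∈ C^∞(ℝ)`")] -/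
theorem exists_lipschitz_smoothRamp :
    ∃ K : ℝ, 0 ≤ K ∧ ∀ a b : ℝ, |smoothRamp a - smoothRamp b| ≤ K * |a - b| := by
  have hcd : ContDiff ℝ 1 smoothRamp := contDiff_smoothRamp
  have hd : Differentiable ℝ smoothRamp := hcd.differentiable one_ne_zero
  have hc : Continuous (deriv smoothRamp) := hcd.continuous_deriv le_rfl
  obtain ⟨C, hC⟩ := (isCompact_Icc (a := (0 : ℝ)) (b := 1)).exists_bound_of_continuousOn hc.continuousOn
  have hzero : ∀ x, x ∉ Icc (0 : ℝ) 1 → deriv smoothRamp x = 0 := by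
    intro x hx
    rw [mem_Icc, not_and_or, not_le, not_le] at hx
    rcases hx with hx | hx
    · have h : smoothRamp =ᶠ[𝓝 x] fun _ ↦ (0 : ℝ) := by
        filter_upwards [Iio_mem_nhds hx] with t ht using smoothRamp_of_nonpos (le_of_lt ht)
      rw [h.deriv_eq, deriv_const]
    · have h : smoothRamp =ᶠ[𝓝 x] fun _ ↦ (1 : ℝ) := by
        filter_upwards [Ioi_mem_nhds hx] with t ht using smoothRamp_of_one_le (le_of_lt ht)
      rw [h.deriv_eq, deriv_const]
  refine ⟨max C 0, le_max_right _ _, fun a b ↦ ?_⟩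
  have hbound : ∀ x ∈ (Set.univ : Set ℝ), ‖deriv smoothRamp x‖ ≤ max C 0 := by
    intro x _
    by_cases hx : x ∈ Icc (0 : ℝ) 1
    · exact (hC x hx).trans (le_max_left _ _)
    · rw [hzero x hx, norm_zero]; exact le_max_right _ _
  have h := Convex.norm_image_sub_le_of_norm_deriv_le (fun x _ ↦ hd x) hbound convex_univ
    (mem_univ b) (mem_univ a)
  simpa [Real.norm_eq_abs] using h

/-- Square roots are Lipschitz above a positive floor: `|√p − √q| ≤ |p − q|/(2√m₀)` for `p, q ≥ m₀ > 0`.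
[folklore] -/
private theorem abs_sqrt_sub_sqrt_le {m₀ p q : ℝ} (hm : 0 < m₀) (hp : m₀ ≤ p) (hq : m₀ ≤ q) :
    |Real.sqrt p - Real.sqrt q| ≤ |p - q| / (2 * Real.sqrt m₀) := by
  have hsp : Real.sqrt m₀ ≤ Real.sqrt p := Real.sqrt_le_sqrt hp
  have hsq : Real.sqrt m₀ ≤ Real.sqrt q := Real.sqrt_le_sqrt hq
  have hs0 : 0 < Real.sqrt m₀ := Real.sqrt_pos.2 hm
  have hsum : 0 < Real.sqrt p + Real.sqrt q := by linarith
  have e : (Real.sqrt p - Real.sqrt q) * (Real.sqrt p + Real.sqrt q) = p - q := by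
    nlinarith [Real.mul_self_sqrt (hm.le.trans hp), Real.mul_self_sqrt (hm.le.trans hq)]
  have e' : |Real.sqrt p - Real.sqrt q| = |p - q| / (Real.sqrt p + Real.sqrt q) := by
    rw [← e, abs_mul, abs_of_pos hsum, mul_div_cancel_right₀ _ hsum.ne']
  rw [e']
  exact div_le_div_of_nonneg_left (abs_nonneg _) (by positivity) (by linarith)

/-- **Regularity constants of a window**: a floor `m₀ > 0` of `ψ` on `[−½,½]`, a bound `B` for `√ψ`,
and a Lipschitz constant `K` for `√ψ` there (from `ψ ∈ C²`, `ψ > 0` on the compact interval).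
[cite: AlpogeFurman2026, §2.2 (p. 4: "even window `ψ ∈ C²([−½,½])` with `ψ > 0`")] -/
theorem IsWindow.exists_bounds (hψ : IsWindow ψ) :
    ∃ m₀ B K : ℝ, 0 < m₀ ∧ 0 ≤ B ∧ 0 ≤ K ∧ (∀ x ∈ Icc (-(1 / 2 : ℝ)) (1 / 2), m₀ ≤ ψ x) ∧
      (∀ x ∈ Icc (-(1 / 2 : ℝ)) (1 / 2), Real.sqrt (ψ x) ≤ B) ∧
      (∀ a ∈ Icc (-(1 / 2 : ℝ)) (1 / 2), ∀ b ∈ Icc (-(1 / 2 : ℝ)) (1 / 2),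
        |Real.sqrt (ψ a) - Real.sqrt (ψ b)| ≤ K * |a - b|) := by
  have hne : (Icc (-(1 / 2 : ℝ)) (1 / 2)).Nonempty := ⟨0, by norm_num, by norm_num⟩
  have hcpt : IsCompact (Icc (-(1 / 2 : ℝ)) (1 / 2)) := isCompact_Icc
  -- floor
  obtain ⟨x₀, hx₀, hmin⟩ := hcpt.exists_isMinOn hne hψ.continuousOn
  -- sup bound
  obtain ⟨C, hC⟩ := hcpt.exists_bound_of_continuousOn hψ.continuousOn
  -- Lipschitz constant of `ψ` from the continuous `derivWithin`
  have hud : UniqueDiffOn ℝ (Icc (-(1 / 2 : ℝ)) (1 / 2)) := uniqueDiffOn_Icc (by norm_num)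
  have hdc : ContinuousOn (derivWithin ψ (Icc (-(1 / 2 : ℝ)) (1 / 2))) (Icc (-(1 / 2 : ℝ)) (1 / 2)) :=
    hψ.contDiffOn.continuousOn_derivWithin hud (by norm_num)
  obtain ⟨C', hC'⟩ := hcpt.exists_bound_of_continuousOn hdc
  have hdiff : DifferentiableOn ℝ ψ (Icc (-(1 / 2 : ℝ)) (1 / 2)) :=
    hψ.contDiffOn.differentiableOn (by norm_num)
  have hlipψ : ∀ a ∈ Icc (-(1 / 2 : ℝ)) (1 / 2), ∀ b ∈ Icc (-(1 / 2 : ℝ)) (1 / 2),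
      |ψ a - ψ b| ≤ max C' 0 * |a - b| := by
    intro a ha b hb
    have h := Convex.norm_image_sub_le_of_norm_derivWithin_le (C := max C' 0) hdiff
      (fun x hx ↦ (hC' x hx).trans (le_max_left C' 0)) (convex_Icc _ _) hb ha
    simpa [Real.norm_eq_abs] using h
  set m₀ := ψ x₀ with hm₀
  have hm₀pos : 0 < m₀ := hψ.pos x₀ hx₀
  refine ⟨m₀, Real.sqrt (max C 0), max C' 0 / (2 * Real.sqrt m₀), hm₀pos, Real.sqrt_nonneg _,
    by positivity, fun x hx ↦ hmin hx, fun x hx ↦ ?_, fun a ha b hb ↦ ?_⟩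
  · refine Real.sqrt_le_sqrt ?_
    have := hC x hx
    rw [Real.norm_eq_abs] at this
    exact (le_abs_self _).trans (this.trans (le_max_left _ _))
  · calc |Real.sqrt (ψ a) - Real.sqrt (ψ b)| ≤ |ψ a - ψ b| / (2 * Real.sqrt m₀) :=
          abs_sqrt_sub_sqrt_le hm₀pos (hmin ha) (hmin hb)
      _ ≤ max C' 0 * |a - b| / (2 * Real.sqrt m₀) :=
          div_le_div_of_nonneg_right (hlipψ a ha b hb) (by positivity)
      _ = max C' 0 / (2 * Real.sqrt m₀) * |a - b| := by ring

/-- The clamp is `1`-Lipschitz. [folklore] -/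
private theorem abs_clampHalf_sub_le (a b : ℝ) : |clampHalf a - clampHalf b| ≤ |a - b| := by
  unfold clampHalf
  have h1 : |min (1 / 2 : ℝ) a - min (1 / 2) b| ≤ |a - b| := abs_min_sub_min_le_max _ _ _ _ |>.trans (by
    simp)
  calc |max (-(1 / 2 : ℝ)) (min (1 / 2) a) - max (-(1 / 2)) (min (1 / 2) b)|
      ≤ |min (1 / 2 : ℝ) a - min (1 / 2) b| := abs_max_sub_max_le_max _ _ _ _ |>.trans (by simp)
    _ ≤ |a - b| := h1


/-! ## §3. The `L¹` modulus of continuity of `φ · e^{y·}` and the decay of `φ̂` off the real axis -/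

/-- The ramp product `r(u) = χ(L/2 + u) χ(L/2 − u)`: values in `[0,1]`, `= 0` for `|u| ≥ L/2`,
`= 1` for `|u| ≤ L/2 − 1`, and `2K_χ`-Lipschitz. [cite: AlpogeFurman2026, §2.2 (p. 4)] -/
private theorem ramp_prod_facts {Kχ : ℝ} (hKχ : ∀ a b : ℝ, |smoothRamp a - smoothRamp b| ≤ Kχ * |a - b|)
    (L : ℝ) :
    (∀ u, 0 ≤ smoothRamp (L / 2 + u) * smoothRamp (L / 2 - u)) ∧
    (∀ u, smoothRamp (L / 2 + u) * smoothRamp (L / 2 - u) ≤ 1) ∧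
    (∀ u, L / 2 ≤ |u| → smoothRamp (L / 2 + u) * smoothRamp (L / 2 - u) = 0) ∧
    (∀ u, |u| ≤ L / 2 - 1 → smoothRamp (L / 2 + u) * smoothRamp (L / 2 - u) = 1) ∧
    (∀ u v, |smoothRamp (L / 2 + u) * smoothRamp (L / 2 - u) -
        smoothRamp (L / 2 + v) * smoothRamp (L / 2 - v)| ≤ 2 * Kχ * |u - v|) := by
  refine ⟨fun u ↦ mul_nonneg (smoothRamp_nonneg _) (smoothRamp_nonneg _), fun u ↦ ?_, fun u hu ↦ ?_,
    fun u hu ↦ ?_, fun u v ↦ ?_⟩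
  · calc smoothRamp (L / 2 + u) * smoothRamp (L / 2 - u) ≤ 1 * 1 :=
          mul_le_mul (smoothRamp_le_one _) (smoothRamp_le_one _) (smoothRamp_nonneg _) zero_le_one
      _ = 1 := one_mul 1
  · rcases le_or_gt 0 u with h | h
    · rw [abs_of_nonneg h] at hu
      rw [smoothRamp_of_nonpos (by linarith : L / 2 - u ≤ 0), mul_zero]
    · rw [abs_of_neg h] at hu
      rw [smoothRamp_of_nonpos (by linarith : L / 2 + u ≤ 0), zero_mul]
  · rw [abs_le] at hu
    rw [smoothRamp_of_one_le (by linarith), smoothRamp_of_one_le (by linarith), mul_one]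
  · have e : smoothRamp (L / 2 + u) * smoothRamp (L / 2 - u) - smoothRamp (L / 2 + v) * smoothRamp (L / 2 - v) =
        smoothRamp (L / 2 + u) * (smoothRamp (L / 2 - u) - smoothRamp (L / 2 - v)) +
          (smoothRamp (L / 2 + u) - smoothRamp (L / 2 + v)) * smoothRamp (L / 2 - v) := by ring
    rw [e]
    have h1 := hKχ (L / 2 - u) (L / 2 - v)
    have h2 := hKχ (L / 2 + u) (L / 2 + v)
    rw [show L / 2 - u - (L / 2 - v) = -(u - v) by ring, abs_neg] at h1
    rw [show L / 2 + u - (L / 2 + v) = u - v by ring] at h2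
    calc |smoothRamp (L / 2 + u) * (smoothRamp (L / 2 - u) - smoothRamp (L / 2 - v)) +
          (smoothRamp (L / 2 + u) - smoothRamp (L / 2 + v)) * smoothRamp (L / 2 - v)|
        ≤ |smoothRamp (L / 2 + u) * (smoothRamp (L / 2 - u) - smoothRamp (L / 2 - v))| +
          |(smoothRamp (L / 2 + u) - smoothRamp (L / 2 + v)) * smoothRamp (L / 2 - v)| := abs_add_le _ _
      _ ≤ 1 * (Kχ * |u - v|) + Kχ * |u - v| * 1 := by
          rw [abs_mul, abs_mul, abs_of_nonneg (smoothRamp_nonneg _), abs_of_nonneg (smoothRamp_nonneg (L / 2 - v))]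
          have hK0 : 0 ≤ Kχ * |u - v| := le_trans (abs_nonneg _) h1
          exact add_le_add (mul_le_mul (smoothRamp_le_one _) h1 (abs_nonneg _) zero_le_one)
            (mul_le_mul h2 (smoothRamp_le_one _) (smoothRamp_nonneg _) hK0)
      _ = 2 * Kχ * |u - v| := by ring

/-- **The `L¹` modulus of continuity of `g = φ · e^{y·}` under a shift `δ ∈ (0, π]`**:
`∫ |g(u) − g(u−δ)| du ≤ δ e^{|y|δ} e^{L|y|/2} (B + K + 4(1+π) K_χ B)`, where `B` bounds `√ψ`, `K` is a
Lipschitz constant of `√ψ` on `[−½,½]` and `K_χ` one of the ramp; `L ≥ 10`, `|y| ≤ ½`. The three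
terms: the exponential factor changes by `|y|δ` (integrated against `e^{yu}` over `[−L/2, L/2]`,
`|y|∫e^{yu} ≤ e^{L|y|/2}`); the window `√ψ(u/L)` is `K/L`-Lipschitz (over length `L`); the ramps move
only on two intervals of length `1 + δ`. [cite: AlpogeFurman2026, eq. (2.9) (p. 4)] -/
theorem integral_norm_shift_sub_le {B K Kχ : ℝ} (hB0 : 0 ≤ B) (hK0 : 0 ≤ K)
    (hKχ0 : 0 ≤ Kχ) (hB : ∀ x ∈ Icc (-(1 / 2 : ℝ)) (1 / 2), Real.sqrt (ψ x) ≤ B)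
    (hK : ∀ a ∈ Icc (-(1 / 2 : ℝ)) (1 / 2), ∀ b ∈ Icc (-(1 / 2 : ℝ)) (1 / 2),
      |Real.sqrt (ψ a) - Real.sqrt (ψ b)| ≤ K * |a - b|)
    (hKχ : ∀ a b : ℝ, |smoothRamp a - smoothRamp b| ≤ Kχ * |a - b|)
    {T : ℝ} (hL : 10 ≤ logHeight T) (y : ℝ) {δ : ℝ} (hδ0 : 0 < δ) (hδ : δ ≤ π) :
    ∫ u : ℝ, ‖((phi ψ T u * Real.exp (y * u) : ℝ) : ℂ) -
        ((phi ψ T (u - δ) * Real.exp (y * (u - δ)) : ℝ) : ℂ)‖ ≤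
      δ * Real.exp (|y| * δ) * Real.exp (logHeight T * |y| / 2) * (B + K + 4 * (1 + π) * Kχ * B) := by
  set L := logHeight T with hLdef
  have hL0 : 0 < L := by linarith
  have hπ := Real.pi_gt_three
  obtain ⟨hr0, hr1, hrzero, hrone, hrlip⟩ := ramp_prod_facts hKχ L
  -- the two factors of `φ`
  set r : ℝ → ℝ := fun u ↦ smoothRamp (L / 2 + u) * smoothRamp (L / 2 - u) with hrdef
  set sψ : ℝ → ℝ := fun u ↦ Real.sqrt (ψ (clampHalf (u / L))) with hsdef
  have hphi : ∀ u, phi ψ T u = r u * sψ u := fun u ↦ by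
    simp only [hrdef, hsdef, phi, ← hLdef]
  have hs0 : ∀ u, 0 ≤ sψ u := fun u ↦ Real.sqrt_nonneg _
  have hsB : ∀ u, sψ u ≤ B := fun u ↦ hB _ (clampHalf_mem _)
  have hslip : ∀ u v, |sψ u - sψ v| ≤ K * |u - v| / L := by
    intro u v
    calc |sψ u - sψ v| ≤ K * |clampHalf (u / L) - clampHalf (v / L)| :=
          hK _ (clampHalf_mem _) _ (clampHalf_mem _)
      _ ≤ K * (|u - v| / L) := by
          refine mul_le_mul_of_nonneg_left ?_ hK0
          calc |clampHalf (u / L) - clampHalf (v / L)| ≤ |u / L - v / L| := abs_clampHalf_sub_le _ _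
            _ = |u - v| / L := by rw [← sub_div, abs_div, abs_of_pos hL0]
      _ = K * |u - v| / L := by ring
  have hphi0 : ∀ u, 0 ≤ phi ψ T u := phi_nonneg ψ T
  have hphiB : ∀ u, phi ψ T u ≤ B := fun u ↦ by
    rw [hphi]
    calc r u * sψ u ≤ 1 * B := mul_le_mul (hr1 u) (hsB u) (hs0 u) zero_le_one
      _ = B := one_mul B
  have hphizero : ∀ u, L / 2 ≤ |u| → phi ψ T u = 0 := fun u hu ↦ by
    rw [hphi, hrdef]; dsimp only; rw [hrzero u hu, zero_mul]
  -- constants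
  set E : ℝ := Real.exp (|y| * (L / 2 + δ)) with hE
  have hEeq : E = Real.exp (|y| * δ) * Real.exp (L * |y| / 2) := by
    rw [hE, ← Real.exp_add]; ring_nf
  have hy0 : 0 ≤ |y| := abs_nonneg y
  have hexp_shift : ∀ u, |u - δ| ≤ L / 2 + δ → Real.exp (y * (u - δ)) ≤ E := by
    intro u hu
    rw [hE]
    refine Real.exp_le_exp.2 ?_
    calc y * (u - δ) ≤ |y * (u - δ)| := le_abs_self _
      _ = |y| * |u - δ| := abs_mul _ _
      _ ≤ |y| * (L / 2 + δ) := mul_le_mul_of_nonneg_left hu hy0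
  -- the three majorants
  set c₁ : ℝ := B * (|y| * δ * Real.exp (|y| * δ)) with hc₁
  set F₁ : ℝ → ℝ := (Icc (-(L / 2)) (L / 2)).indicator fun u ↦ c₁ * Real.exp (y * u) with hF₁
  set c₂ : ℝ := K * δ / L * E with hc₂
  set F₂ : ℝ → ℝ := (Icc (-(L / 2)) (L / 2)).indicator fun _ ↦ c₂ with hF₂
  set c₃ : ℝ := 2 * Kχ * δ * B * E with hc₃
  set F₃ : ℝ → ℝ := fun u ↦ (Icc (-(L / 2)) (-(L / 2) + 1 + δ)).indicator (fun _ ↦ c₃) u +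
    (Icc (L / 2 - 1) (L / 2 + δ)).indicator (fun _ ↦ c₃) u with hF₃
  have hc₁0 : 0 ≤ c₁ := by positivity
  have hc₂0 : 0 ≤ c₂ := by positivity
  have hc₃0 : 0 ≤ c₃ := by positivity
  -- pointwise bound
  have hpt : ∀ u : ℝ, ‖((phi ψ T u * Real.exp (y * u) : ℝ) : ℂ) -
      ((phi ψ T (u - δ) * Real.exp (y * (u - δ)) : ℝ) : ℂ)‖ ≤ F₁ u + F₂ u + F₃ u := by
    intro u
    rw [← Complex.ofReal_sub, Complex.norm_real, Real.norm_eq_abs]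
    have esplit : phi ψ T u * Real.exp (y * u) - phi ψ T (u - δ) * Real.exp (y * (u - δ)) =
        phi ψ T u * (Real.exp (y * u) - Real.exp (y * (u - δ))) +
          (r u * (sψ u - sψ (u - δ))) * Real.exp (y * (u - δ)) +
          ((r u - r (u - δ)) * sψ (u - δ)) * Real.exp (y * (u - δ)) := by
      rw [hphi, hphi]; ring
    rw [esplit]
    refine (abs_add_le _ _).trans (add_le_add ((abs_add_le _ _).trans (add_le_add ?_ ?_)) ?_)
    · -- term 1 ≤ F₁ u
      by_cases hu : u ∈ Icc (-(L / 2)) (L / 2)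
      · rw [hF₁, indicator_of_mem hu]
        have e1 : Real.exp (y * u) - Real.exp (y * (u - δ)) = Real.exp (y * u) * (1 - Real.exp (-(y * δ))) := by
          rw [show y * (u - δ) = y * u + -(y * δ) by ring, Real.exp_add]; ring
        rw [e1, abs_mul, abs_mul, abs_of_nonneg (hphi0 u), abs_of_pos (Real.exp_pos _)]
        have e2 : |1 - Real.exp (-(y * δ))| ≤ |y| * δ * Real.exp (|y| * δ) := by
          rw [abs_sub_comm]
          have := abs_exp_sub_one_le_mul (-(y * δ))
          rw [abs_neg, abs_mul, abs_of_pos hδ0] at this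
          exact this
        calc phi ψ T u * (Real.exp (y * u) * |1 - Real.exp (-(y * δ))|)
            ≤ B * (Real.exp (y * u) * (|y| * δ * Real.exp (|y| * δ))) :=
              mul_le_mul (hphiB u) (mul_le_mul_of_nonneg_left e2 (Real.exp_nonneg _))
                (mul_nonneg (Real.exp_nonneg _) (abs_nonneg _)) hB0
          _ = c₁ * Real.exp (y * u) := by rw [hc₁]; ring
      · have hu' : L / 2 ≤ |u| := by
          rw [mem_Icc, not_and_or, not_le, not_le] at hu
          rcases hu with hu | hu
          · rw [abs_of_neg (by linarith)]; linarith
          · rw [abs_of_pos (by linarith)]; linarith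
        rw [hphizero u hu', zero_mul, abs_zero, hF₁, indicator_of_notMem hu]
    · -- term 2 ≤ F₂ u
      by_cases hu : u ∈ Icc (-(L / 2)) (L / 2)
      · rw [hF₂, indicator_of_mem hu, abs_mul, abs_mul, abs_of_nonneg (hr0 u), abs_of_pos (Real.exp_pos _)]
        have hud : |u - δ| ≤ L / 2 + δ := by
          have : |u| ≤ L / 2 := abs_le.2 ⟨hu.1, hu.2⟩
          calc |u - δ| ≤ |u| + |δ| := abs_sub _ _
            _ ≤ L / 2 + δ := by rw [abs_of_pos hδ0]; linarith
        have hs' : |sψ u - sψ (u - δ)| ≤ K * δ / L := by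
          have := hslip u (u - δ)
          rwa [show u - (u - δ) = δ by ring, abs_of_pos hδ0] at this
        have a1 : r u * |sψ u - sψ (u - δ)| ≤ 1 * (K * δ / L) :=
          mul_le_mul (hr1 u) hs' (abs_nonneg _) zero_le_one
        calc r u * |sψ u - sψ (u - δ)| * Real.exp (y * (u - δ)) ≤ 1 * (K * δ / L) * E :=
              mul_le_mul a1 (hexp_shift u hud) (Real.exp_nonneg _) (by positivity)
          _ = c₂ := by rw [hc₂]; ring
      · have hu' : L / 2 ≤ |u| := by
          rw [mem_Icc, not_and_or, not_le, not_le] at hu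
          rcases hu with hu | hu
          · rw [abs_of_neg (by linarith)]; linarith
          · rw [abs_of_pos (by linarith)]; linarith
        have : r u = 0 := hrzero u hu'
        rw [this, zero_mul, zero_mul, abs_zero, hF₂, indicator_of_notMem hu]
    · -- term 3 ≤ F₃ u
      by_cases hb : u ∈ Icc (-(L / 2)) (-(L / 2) + 1 + δ) ∨ u ∈ Icc (L / 2 - 1) (L / 2 + δ)
      · -- on the transition intervals
        have hud : |u - δ| ≤ L / 2 + δ := by
          rw [abs_le]
          rcases hb with hb | hb
          · constructor <;> linarith [hb.1, hb.2]
          · constructor <;> linarith [hb.1, hb.2]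
        have hval : |(r u - r (u - δ)) * sψ (u - δ) * Real.exp (y * (u - δ))| ≤ c₃ := by
          rw [abs_mul, abs_mul, abs_of_nonneg (hs0 _), abs_of_pos (Real.exp_pos _)]
          have h1 : |r u - r (u - δ)| ≤ 2 * Kχ * δ := by
            have := hrlip u (u - δ)
            rwa [show u - (u - δ) = δ by ring, abs_of_pos hδ0] at this
          calc |r u - r (u - δ)| * sψ (u - δ) * Real.exp (y * (u - δ)) ≤ 2 * Kχ * δ * B * E :=
                mul_le_mul (mul_le_mul h1 (hsB _) (hs0 _) (by positivity)) (hexp_shift u hud)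
                  (Real.exp_nonneg _) (by positivity)
            _ = c₃ := by rw [hc₃]
        have hF₃ge : c₃ ≤ F₃ u := by
          rw [hF₃]
          dsimp only
          rcases hb with hb | hb
          · rw [indicator_of_mem hb]
            have : 0 ≤ (Icc (L / 2 - 1) (L / 2 + δ)).indicator (fun _ ↦ c₃) u :=
              Set.indicator_nonneg (fun _ _ ↦ hc₃0) u
            linarith
          · rw [indicator_of_mem hb]
            have : 0 ≤ (Icc (-(L / 2)) (-(L / 2) + 1 + δ)).indicator (fun _ ↦ c₃) u :=
              Set.indicator_nonneg (fun _ _ ↦ hc₃0) u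
            linarith
        exact hval.trans hF₃ge
      · -- off the transition intervals the ramp product does not move
        rw [not_or] at hb
        have hreq : r u = r (u - δ) := by
          simp only [mem_Icc, not_and_or, not_le] at hb
          rcases hb with ⟨hb1 | hb1, hb2 | hb2⟩
          · -- u < -L/2: both vanish
            rw [hrdef]; dsimp only
            rw [hrzero u (by rw [abs_of_neg (by linarith)]; linarith),
              hrzero (u - δ) (by rw [abs_of_neg (by linarith)]; linarith)]
          · -- u < -L/2 and u > L/2 + δ: impossible
            exfalso; linarith
          · -- -L/2+1+δ < u and u < L/2 - 1: both equal 1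
            rw [hrdef]; dsimp only
            rw [hrone u (by rw [abs_le]; constructor <;> linarith),
              hrone (u - δ) (by rw [abs_le]; constructor <;> linarith)]
          · -- u > L/2 + δ: both vanish
            rw [hrdef]; dsimp only
            rw [hrzero u (by rw [abs_of_pos (by linarith)]; linarith),
              hrzero (u - δ) (by rw [abs_of_pos (by linarith)]; linarith)]
        rw [hreq, sub_self, zero_mul, zero_mul, abs_zero]
        have : 0 ≤ F₃ u := by
          rw [hF₃]
          exact add_nonneg (Set.indicator_nonneg (fun _ _ ↦ hc₃0) u) (Set.indicator_nonneg (fun _ _ ↦ hc₃0) u)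
        exact this
  -- integrability of the majorants
  have hI₁ : Integrable F₁ := by
    rw [hF₁]
    refine IntegrableOn.integrable_indicator ?_ measurableSet_Icc
    exact (continuous_const.mul (Real.continuous_exp.comp (continuous_const.mul continuous_id))).integrableOn_Icc
  have hI₂ : Integrable F₂ := by
    rw [hF₂]
    exact IntegrableOn.integrable_indicator (continuous_const.integrableOn_Icc) measurableSet_Icc
  have hI₃ : Integrable F₃ := by
    rw [hF₃]
    exact (IntegrableOn.integrable_indicator (continuous_const.integrableOn_Icc) measurableSet_Icc).add
      (IntegrableOn.integrable_indicator (continuous_const.integrableOn_Icc) measurableSet_Icc)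
  -- the integrals of the majorants
  have hJ₁ : ∫ u, F₁ u ≤ B * δ * Real.exp (|y| * δ) * Real.exp (L * |y| / 2) := by
    rw [hF₁, integral_indicator measurableSet_Icc, integral_const_mul, integral_Icc_eq_integral_Ioc,
      ← intervalIntegral.integral_of_le (by linarith : -(L / 2) ≤ L / 2)]
    have h := abs_mul_integral_exp_le (y := y) (R := L / 2) (by linarith)
    rw [show |y| * (L / 2) = L * |y| / 2 by ring] at h
    have hI0 : 0 ≤ ∫ u in -(L / 2)..L / 2, Real.exp (y * u) :=
      intervalIntegral.integral_nonneg (by linarith) fun u _ ↦ (Real.exp_pos _).le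
    calc c₁ * ∫ u in -(L / 2)..L / 2, Real.exp (y * u)
        = B * δ * Real.exp (|y| * δ) * (|y| * ∫ u in -(L / 2)..L / 2, Real.exp (y * u)) := by rw [hc₁]; ring
      _ ≤ B * δ * Real.exp (|y| * δ) * Real.exp (L * |y| / 2) :=
          mul_le_mul_of_nonneg_left h (by positivity)
  have hJ₂ : ∫ u, F₂ u = K * δ * Real.exp (|y| * δ) * Real.exp (L * |y| / 2) := by
    rw [hF₂, integral_indicator_const _ measurableSet_Icc, Real.volume_real_Icc_of_le (by linarith),
      smul_eq_mul, hc₂, hEeq]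
    field_simp
    ring
  have hJ₃ : ∫ u, F₃ u ≤ 4 * (1 + π) * Kχ * B * δ * Real.exp (|y| * δ) * Real.exp (L * |y| / 2) := by
    rw [hF₃, integral_add (IntegrableOn.integrable_indicator (continuous_const.integrableOn_Icc) measurableSet_Icc)
      (IntegrableOn.integrable_indicator (continuous_const.integrableOn_Icc) measurableSet_Icc),
      integral_indicator_const _ measurableSet_Icc, integral_indicator_const _ measurableSet_Icc,
      Real.volume_real_Icc_of_le (by linarith), Real.volume_real_Icc_of_le (by linarith), smul_eq_mul,
      smul_eq_mul]
    have e : (-(L / 2) + 1 + δ - -(L / 2)) * c₃ + (L / 2 + δ - (L / 2 - 1)) * c₃ =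
        2 * (1 + δ) * (2 * Kχ * δ * B) * (Real.exp (|y| * δ) * Real.exp (L * |y| / 2)) := by
      rw [hc₃, hEeq]; ring
    rw [e]
    have h1 : 2 * (1 + δ) * (2 * Kχ * δ * B) ≤ 4 * (1 + π) * Kχ * B * δ := by
      have : 0 ≤ Kχ * δ * B := by positivity
      nlinarith
    have h2 : 0 ≤ Real.exp (|y| * δ) * Real.exp (L * |y| / 2) := by positivity
    nlinarith
  -- conclude
  have hI12 : Integrable (fun u ↦ F₁ u + F₂ u) := hI₁.add hI₂
  have hI123 : Integrable (fun u ↦ F₁ u + F₂ u + F₃ u) := hI12.add hI₃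
  have hmono : ∫ u : ℝ, ‖((phi ψ T u * Real.exp (y * u) : ℝ) : ℂ) -
      ((phi ψ T (u - δ) * Real.exp (y * (u - δ)) : ℝ) : ℂ)‖ ≤ ∫ u, (F₁ u + F₂ u + F₃ u) :=
    integral_mono_of_nonneg (Eventually.of_forall fun u ↦ norm_nonneg _) hI123
      (Eventually.of_forall hpt)
  rw [integral_add hI12 hI₃, integral_add hI₁ hI₂] at hmono
  have : B * δ * Real.exp (|y| * δ) * Real.exp (L * |y| / 2) + K * δ * Real.exp (|y| * δ) * Real.exp (L * |y| / 2) +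
      4 * (1 + π) * Kχ * B * δ * Real.exp (|y| * δ) * Real.exp (L * |y| / 2) =
      δ * Real.exp (|y| * δ) * Real.exp (L * |y| / 2) * (B + K + 4 * (1 + π) * Kχ * B) := by ring
  linarith


/-- `φ̂` is even for an even window: `φ̂(−w) = φ̂(w)` (substitute `u ↦ −u`).
[cite: AlpogeFurman2026, §5.1 (p. 7: "`φ̂` and `Φ` are real, even, entire")] -/
theorem hat_neg_of_even {φ : ℝ → ℝ} (heven : ∀ u, φ (-u) = φ u) (w : ℂ) :
    hat (fun u ↦ (φ u : ℂ)) (-w) = hat (fun u ↦ (φ u : ℂ)) w := by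
  simp only [hat]
  rw [← integral_neg_eq_self (fun u : ℝ ↦ (φ u : ℂ) * cexp (-(I * w * u))) volume]
  refine integral_congr_ae (Eventually.of_forall fun u ↦ ?_)
  dsimp only
  rw [heven]
  congr 1
  push_cast
  ring_nf

/-- `φ · e^{y·}` (cast to `ℂ`) is integrable: continuous with compact support.
[cite: AlpogeFurman2026, §2.2 (p. 4)] -/
theorem integrable_phi_mul_exp (hψ : IsWindow ψ) (T y : ℝ) :
    Integrable fun u : ℝ ↦ ((phi ψ T u * Real.exp (y * u) : ℝ) : ℂ) := by
  have hc : Continuous fun u : ℝ ↦ ((phi ψ T u * Real.exp (y * u) : ℝ) : ℂ) :=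
    Complex.continuous_ofReal.comp ((hψ.continuous_phi T).mul (Real.continuous_exp.comp
      (continuous_const.mul continuous_id)))
  refine hc.integrable_of_hasCompactSupport ?_
  exact ((hasCompactSupport_phi ψ T).mul_right (f' := fun u : ℝ ↦ Real.exp (y * u))).comp_left
    Complex.ofReal_zero

/-- **Decay of `φ̂` off the real axis, [AF26] (2.9) in the form used for Proposition 4.2**: for a
window, `L = log(T/2π) ≥ 10`, `|y| ≤ ½` and real `|ξ| ≥ 1`,
`|φ̂(ξ + iy)| ≤ C_dec e^{L|y|/2}/|ξ|` with `C_dec = (π/2) e^{π/2} (B + K + 4(1+π) K_χ B)` depending only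
on the window (`B, K`) and the ramp (`K_χ`) — by the translation trick and the `L¹` modulus bound.
(The printed (2.9) has `min(L, |z|⁻¹, |z|⁻²)`; the first-order decay suffices here.)
[cite: AlpogeFurman2026, eq. (2.9) (p. 4) and Proposition 4.2 (proof), p. 6] -/
theorem norm_hat_phi_le (hψ : IsWindow ψ) {B K Kχ : ℝ} (hB0 : 0 ≤ B) (hK0 : 0 ≤ K) (hKχ0 : 0 ≤ Kχ)
    (hB : ∀ x ∈ Icc (-(1 / 2 : ℝ)) (1 / 2), Real.sqrt (ψ x) ≤ B)
    (hK : ∀ a ∈ Icc (-(1 / 2 : ℝ)) (1 / 2), ∀ b ∈ Icc (-(1 / 2 : ℝ)) (1 / 2),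
      |Real.sqrt (ψ a) - Real.sqrt (ψ b)| ≤ K * |a - b|)
    (hKχ : ∀ a b : ℝ, |smoothRamp a - smoothRamp b| ≤ Kχ * |a - b|)
    {T : ℝ} (hL : 10 ≤ logHeight T) {y : ℝ} (hy : |y| ≤ 1 / 2) {ξ : ℝ} (hξ : 1 ≤ |ξ|) :
    ‖hat (fun u ↦ (phi ψ T u : ℂ)) ((ξ : ℂ) + (y : ℂ) * I)‖ ≤
      (π / 2 * Real.exp (π / 2) * (B + K + 4 * (1 + π) * Kχ * B)) *
        Real.exp (logHeight T * |y| / 2) / |ξ| := by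
  have hπ := Real.pi_gt_three
  -- the case of a positive frequency
  have main : ∀ (y ξ : ℝ), |y| ≤ 1 / 2 → 1 ≤ ξ →
      ‖hat (fun u ↦ (phi ψ T u : ℂ)) ((ξ : ℂ) + (y : ℂ) * I)‖ ≤
        (π / 2 * Real.exp (π / 2) * (B + K + 4 * (1 + π) * Kχ * B)) *
          Real.exp (logHeight T * |y| / 2) / ξ := by
    intro y ξ hy hξ
    have hξ0 : 0 < ξ := by linarith
    rw [hat_ofReal_add_mul_I]
    have h1 := norm_hat_le_half_integral_sub_shift (integrable_phi_mul_exp hψ T y) hξ0.ne'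
    have hδ0 : 0 < π / ξ := by positivity
    have hδ : π / ξ ≤ π := div_le_self (by linarith) hξ
    have h2 := integral_norm_shift_sub_le hB0 hK0 hKχ0 hB hK hKχ hL y hδ0 hδ
    have h3 : Real.exp (|y| * (π / ξ)) ≤ Real.exp (π / 2) := by
      refine Real.exp_le_exp.2 ?_
      calc |y| * (π / ξ) ≤ (1 / 2) * π := mul_le_mul hy hδ hδ0.le (by norm_num)
        _ = π / 2 := by ring
    have hC0 : 0 ≤ B + K + 4 * (1 + π) * Kχ * B := by positivity
    calc ‖hat (fun u ↦ (((phi ψ T u * Real.exp (y * u) : ℝ)) : ℂ)) ξ‖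
        ≤ (1 / 2) * ∫ u : ℝ, ‖((phi ψ T u * Real.exp (y * u) : ℝ) : ℂ) -
            ((phi ψ T (u - π / ξ) * Real.exp (y * (u - π / ξ)) : ℝ) : ℂ)‖ := h1
      _ ≤ (1 / 2) * (π / ξ * Real.exp (|y| * (π / ξ)) * Real.exp (logHeight T * |y| / 2) *
            (B + K + 4 * (1 + π) * Kχ * B)) := mul_le_mul_of_nonneg_left h2 (by norm_num)
      _ ≤ (1 / 2) * (π / ξ * Real.exp (π / 2) * Real.exp (logHeight T * |y| / 2) *
            (B + K + 4 * (1 + π) * Kχ * B)) := by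
          have : 0 ≤ π / ξ := hδ0.le
          have : 0 ≤ Real.exp (logHeight T * |y| / 2) := Real.exp_nonneg _
          gcongr
      _ = (π / 2 * Real.exp (π / 2) * (B + K + 4 * (1 + π) * Kχ * B)) *
            Real.exp (logHeight T * |y| / 2) / ξ := by
          field_simp
  rcases le_or_gt 0 ξ with h0 | h0
  · rw [abs_of_nonneg h0] at hξ ⊢
    exact main y ξ hy hξ
  · rw [abs_of_neg h0] at hξ ⊢
    have e : ((ξ : ℂ) + (y : ℂ) * I) = -(((-ξ : ℝ) : ℂ) + ((-y : ℝ) : ℂ) * I) := by push_cast; ring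
    rw [e, hat_neg_of_even (phi_neg hψ.even T)]
    have := main (-y) (-ξ) (by rwa [abs_neg]) hξ
    rwa [abs_neg] at this

/-! ## §4. Gabor over `ℤ` at a complex point: `Σ_k |φ̂(z − α_k)|² = L ∫ φ² e^{2 Im z · u} ≤ e^{L|Im z|} · aL²` -/

/-- The weighted norm identity: for a window and `L > 0`,
`Σ_{k ∈ ℤ} |φ̂(z − α_k)|² = L ∫ φ(u)² e^{2 (Im z) u} du` (Lemma 2.1 without evenness at `(z, z̄)`,
and `φ̂(z̄ − α_k) = conj φ̂(z − α_k)`). [cite: AlpogeFurman2026, Lemma 2.1 (p. 4)] -/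
theorem hasSum_norm_sq_hat_phi (hψ : IsWindow ψ) {T : ℝ} (hL : 0 < logHeight T) (z : ℂ) :
    HasSum (fun k : ℤ ↦ ‖hat (fun u ↦ (phi ψ T u : ℂ)) (z - grid T (logHeight T) k)‖ ^ 2)
      (logHeight T * ∫ u : ℝ, phi ψ T u ^ 2 * Real.exp (2 * z.im * u)) := by
  have hφc : Continuous fun u : ℝ ↦ (phi ψ T u : ℂ) :=
    Complex.continuous_ofReal.comp (hψ.continuous_phi T)
  have hsupp : Function.support (fun u : ℝ ↦ (phi ψ T u : ℂ)) ⊆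
      Ioo (-(logHeight T / 2)) (logHeight T / 2) := by
    intro u hu
    apply support_phi_subset ψ T
    rw [Function.mem_support] at hu ⊢
    exact_mod_cast hu
  have h := hasSum_hat_mul_hat hL T hφc hsupp z (conj z)
  -- identify the terms
  have hterm : ∀ k : ℤ, hat (fun u ↦ (phi ψ T u : ℂ)) (z - grid T (logHeight T) k) *
      hat (fun u ↦ (phi ψ T u : ℂ)) (conj z - grid T (logHeight T) k) =
      ((‖hat (fun u ↦ (phi ψ T u : ℂ)) (z - grid T (logHeight T) k)‖ ^ 2 : ℝ) : ℂ) := by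
    intro k
    rw [show conj z - (grid T (logHeight T) k : ℂ) = conj (z - grid T (logHeight T) k) by
      rw [map_sub, Complex.conj_ofReal], hat_conj_of_even (phi_neg hψ.even T), Complex.mul_conj,
      Complex.normSq_eq_norm_sq, Complex.ofReal_pow]
  -- identify the sum
  have hval : (logHeight T : ℂ) * hat (fun u ↦ (phi ψ T u : ℂ) * (phi ψ T (-u) : ℂ)) (z - conj z) =
      ((logHeight T * ∫ u : ℝ, phi ψ T u ^ 2 * Real.exp (2 * z.im * u) : ℝ) : ℂ) := by
    rw [Complex.sub_conj, hat]
    push_cast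
    congr 1
    rw [← integral_complex_ofReal]
    refine integral_congr_ae (Eventually.of_forall fun u ↦ ?_)
    dsimp only
    rw [phi_neg hψ.even T]
    have : -(I * (2 * (z.im : ℂ) * I) * u) = ((2 * z.im * u : ℝ) : ℂ) := by
      have hI : I * I = -1 := Complex.I_mul_I
      push_cast
      linear_combination (-(2 : ℂ) * z.im * u) * hI
    rw [this, ← Complex.ofReal_exp]
    push_cast
    ring
  simp_rw [hterm] at h
  rw [hval] at h
  exact Complex.hasSum_ofReal.1 h

/-- Hence `Σ_{k ∈ ℤ} |φ̂(z − α_k)|² ≤ e^{L|Im z|} · L ∫ φ²` (`e^{2yu} ≤ e^{L|y|}` on the support).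
[cite: AlpogeFurman2026, Lemma 2.1 (p. 4) and Proposition 4.2 (proof), p. 6] -/
theorem integral_sq_phi_exp_le (hψ : IsWindow ψ) {T : ℝ} (hL : 0 < logHeight T) (y : ℝ) :
    logHeight T * ∫ u : ℝ, phi ψ T u ^ 2 * Real.exp (2 * y * u) ≤
      Real.exp (logHeight T * |y|) * (logHeight T * ∫ u : ℝ, phi ψ T u ^ 2) := by
  have hint : ∫ u : ℝ, phi ψ T u ^ 2 * Real.exp (2 * y * u) ≤
      ∫ u : ℝ, Real.exp (logHeight T * |y|) * phi ψ T u ^ 2 := by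
    refine integral_mono_of_nonneg (Eventually.of_forall fun u ↦ by positivity) ?_
      (Eventually.of_forall fun u ↦ ?_)
    · have hK2 : HasCompactSupport fun u : ℝ ↦ phi ψ T u ^ 2 := by
        have h := (hasCompactSupport_phi ψ T).mul_right (f' := phi ψ T)
        have e : (fun u : ℝ ↦ phi ψ T u ^ 2) = phi ψ T * phi ψ T := by
          funext u; simp [pow_two]
        rw [e]; exact h
      exact (((hψ.continuous_phi T).pow 2).integrable_of_hasCompactSupport hK2).const_mul _
    · dsimp only
      by_cases hu : phi ψ T u = 0
      · rw [hu]; simp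
      · have hmem := support_phi_subset ψ T (Function.mem_support.2 hu)
        rw [mul_comm]
        refine mul_le_mul_of_nonneg_right (Real.exp_le_exp.2 ?_) (sq_nonneg _)
        have : |u| ≤ logHeight T / 2 := abs_le.2 ⟨hmem.1.le, hmem.2.le⟩
        calc 2 * y * u ≤ |2 * y * u| := le_abs_self _
          _ = 2 * |y| * |u| := by rw [abs_mul, abs_mul, abs_two]
          _ ≤ 2 * |y| * (logHeight T / 2) := by gcongr
          _ = logHeight T * |y| := by ring
  rw [integral_const_mul] at hint
  calc logHeight T * ∫ u : ℝ, phi ψ T u ^ 2 * Real.exp (2 * y * u)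
      ≤ logHeight T * (Real.exp (logHeight T * |y|) * ∫ u : ℝ, phi ψ T u ^ 2) :=
        mul_le_mul_of_nonneg_left hint hL.le
    _ = Real.exp (logHeight T * |y|) * (logHeight T * ∫ u : ℝ, phi ψ T u ^ 2) := by ring

/-- Hence `Σ_{k ∈ ℤ} |φ̂(z − α_k)|² ≤ e^{L|Im z|} · L ∫ φ²` (`e^{2yu} ≤ e^{L|y|}` on the support).
[cite: AlpogeFurman2026, Lemma 2.1 (p. 4) and Proposition 4.2 (proof), p. 6] -/
theorem tsum_norm_sq_hat_phi_le (hψ : IsWindow ψ) {T : ℝ} (hL : 0 < logHeight T) (z : ℂ) :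
    ∑' k : ℤ, ‖hat (fun u ↦ (phi ψ T u : ℂ)) (z - grid T (logHeight T) k)‖ ^ 2 ≤
      Real.exp (logHeight T * |z.im|) * (logHeight T * ∫ u : ℝ, phi ψ T u ^ 2) := by
  rw [(hasSum_norm_sq_hat_phi hψ hL z).tsum_eq]
  exact integral_sq_phi_exp_le hψ hL z.im

/-- Any finite part of the Gabor sum of `|φ̂|²` is bounded by `e^{L|Im z|} L∫φ²`.
[cite: AlpogeFurman2026, Lemma 2.1 (p. 4)] -/
theorem sum_norm_sq_hat_phi_le (hψ : IsWindow ψ) {T : ℝ} (hL : 0 < logHeight T) (z : ℂ)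
    (S : Finset ℤ) :
    ∑ k ∈ S, ‖hat (fun u ↦ (phi ψ T u : ℂ)) (z - grid T (logHeight T) k)‖ ^ 2 ≤
      Real.exp (logHeight T * |z.im|) * (logHeight T * ∫ u : ℝ, phi ψ T u ^ 2) :=
  (sum_le_hasSum S (fun _ _ ↦ sq_nonneg _) (hasSum_norm_sq_hat_phi hψ hL z)).trans
    (integral_sq_phi_exp_le hψ hL z.im)

/-- **Lemma 2.1 (diagonal) at a complex point, real form of the value**: `Σ_{k ∈ ℤ} φ̂(z − α_k)² = L∫φ²`
(`= aL²`). [cite: AlpogeFurman2026, Lemma 2.1 (p. 4)] -/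
theorem hasSum_sq_hat_phi (hψ : IsWindow ψ) {T : ℝ} (hL : 0 < logHeight T) (z : ℂ) :
    HasSum (fun k : ℤ ↦ hat (fun u ↦ (phi ψ T u : ℂ)) (z - grid T (logHeight T) k) ^ 2)
      (((logHeight T * ∫ u : ℝ, phi ψ T u ^ 2 : ℝ)) : ℂ) := by
  have hφc : Continuous fun u : ℝ ↦ (phi ψ T u : ℂ) :=
    Complex.continuous_ofReal.comp (hψ.continuous_phi T)
  have hsupp : Function.support (fun u : ℝ ↦ (phi ψ T u : ℂ)) ⊆
      Ioo (-(logHeight T / 2)) (logHeight T / 2) := by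
    intro u hu
    apply support_phi_subset ψ T
    rw [Function.mem_support] at hu ⊢
    exact_mod_cast hu
  have h := AlpogeFurman2026_poisson_gabor_diag hL T hφc hsupp
    (fun u ↦ by rw [phi_neg hψ.even T]) z
  have e : (logHeight T : ℂ) * ∫ u : ℝ, (phi ψ T u : ℂ) ^ 2 =
      (((logHeight T * ∫ u : ℝ, phi ψ T u ^ 2 : ℝ)) : ℂ) := by
    push_cast
    rw [← integral_complex_ofReal]
    simp_rw [Complex.ofReal_pow]
  rwa [e] at h


/-! ## §5. Per-zero bounds: the tail of the Gabor sum outside `0 ≤ k < d` -/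

/-- Reindexed arithmetic-progression sums: if `ι` is injective on `s` then
`Σ_{k ∈ s} 1/(D′ + ι(k) h)² ≤ 1/D′² + 1/(hD′)`. [cite: AlpogeFurman2026, Proposition 4.2 (proof), p. 6] -/
theorem sum_inv_sq_reindex_le {s : Finset ℤ} {ι : ℤ → ℕ} (hinj : Set.InjOn ι ↑s) {D' h : ℝ}
    (hD' : 0 < D') (hh : 0 < h) :
    ∑ k ∈ s, 1 / (D' + (ι k : ℝ) * h) ^ 2 ≤ 1 / D' ^ 2 + 1 / (h * D') := by
  classical
  rw [← Finset.sum_image (f := fun j : ℕ ↦ 1 / (D' + (j : ℝ) * h) ^ 2) hinj]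
  obtain ⟨N, hN⟩ : ∃ N : ℕ, s.image ι ⊆ Finset.range N := by
    refine ⟨(s.image ι).sup id + 1, fun j hj ↦ Finset.mem_range.2 ?_⟩
    have := Finset.le_sup (f := id) hj
    simp only [id] at this
    omega
  exact (Finset.sum_le_sum_of_subset_of_nonneg hN fun _ _ _ ↦ by positivity).trans
    (sum_inv_sq_arith_le hD' hh N)

/-- `z − α_k = (Re z − α_k) + i Im z`. [folklore] -/
private theorem sub_grid_eq (z : ℂ) (T L : ℝ) (k : ℤ) :
    z - (grid T L k : ℂ) = ((z.re - grid T L k : ℝ) : ℂ) + (z.im : ℂ) * I := by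
  apply Complex.ext <;> simp

/-- The squared decay bound at a grid frequency: if `|Re z − α_k| = D′ + n h ≥ 1` (`h = 2π/L`) then
`|φ̂(z − α_k)|² ≤ C_dec² e^{L|Im z|}/(D′ + n h)²`. [cite: AlpogeFurman2026, eq. (2.9) and Proposition 4.2 (proof), pp. 4, 6] -/
theorem norm_sq_hat_phi_grid_le (hψ : IsWindow ψ) {B K Kχ : ℝ} (hB0 : 0 ≤ B) (hK0 : 0 ≤ K)
    (hKχ0 : 0 ≤ Kχ) (hB : ∀ x ∈ Icc (-(1 / 2 : ℝ)) (1 / 2), Real.sqrt (ψ x) ≤ B)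
    (hK : ∀ a ∈ Icc (-(1 / 2 : ℝ)) (1 / 2), ∀ b ∈ Icc (-(1 / 2 : ℝ)) (1 / 2),
      |Real.sqrt (ψ a) - Real.sqrt (ψ b)| ≤ K * |a - b|)
    (hKχ : ∀ a b : ℝ, |smoothRamp a - smoothRamp b| ≤ Kχ * |a - b|)
    {T : ℝ} (hL : 10 ≤ logHeight T) {z : ℂ} (hy : |z.im| ≤ 1 / 2) {k : ℤ} {D' : ℝ} {n : ℕ}
    (hD' : 1 ≤ D') (hξ : |z.re - grid T (logHeight T) k| = D' + n * (2 * π / logHeight T)) :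
    ‖hat (fun u ↦ (phi ψ T u : ℂ)) (z - grid T (logHeight T) k)‖ ^ 2 ≤
      (π / 2 * Real.exp (π / 2) * (B + K + 4 * (1 + π) * Kχ * B)) ^ 2 *
        Real.exp (logHeight T * |z.im|) / (D' + n * (2 * π / logHeight T)) ^ 2 := by
  have hπ := Real.pi_gt_three
  have hL0 : 0 < logHeight T := by linarith
  have hpos : 1 ≤ |z.re - grid T (logHeight T) k| := by
    rw [hξ]; have : 0 ≤ (n : ℝ) * (2 * π / logHeight T) := by positivity
    linarith
  have h := norm_hat_phi_le hψ hB0 hK0 hKχ0 hB hK hKχ hL hy hpos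
  rw [← sub_grid_eq] at h
  have h0 : 0 ≤ ‖hat (fun u ↦ (phi ψ T u : ℂ)) (z - grid T (logHeight T) k)‖ := norm_nonneg _
  have h2 := mul_self_le_mul_self h0 h
  rw [← pow_two] at h2
  refine h2.trans (le_of_eq ?_)
  rw [hξ]
  have e2 : Real.exp (logHeight T * |z.im|) =
      Real.exp (logHeight T * |z.im| / 2) * Real.exp (logHeight T * |z.im| / 2) := by
    rw [← Real.exp_add]; ring_nf
  rw [e2]
  have hne : D' + (n : ℝ) * (2 * π / logHeight T) ≠ 0 := by
    have : 0 ≤ (n : ℝ) * (2 * π / logHeight T) := by positivity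
    linarith
  field_simp

/-- Auxiliary: `h = 2π/L ∈ (0, 1]` for `L ≥ 10`. [cite: AlpogeFurman2026, §2.2 (p. 4)] -/
private theorem grid_step_bounds {T : ℝ} (hL : 10 ≤ logHeight T) :
    0 < 2 * π / logHeight T ∧ 2 * π / logHeight T ≤ 1 := by
  have hπ := Real.pi_gt_three
  have hπ4 := Real.pi_lt_d4
  have hL0 : 0 < logHeight T := by linarith
  refine ⟨by positivity, ?_⟩
  rw [div_le_one hL0]; linarith

/-- Auxiliary: `α_k = T + k h`. [cite: AlpogeFurman2026, §2.2 (p. 4)] -/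
private theorem grid_eq' (T L : ℝ) (k : ℤ) : grid T L k = T + (k : ℝ) * (2 * π / L) := by
  rw [grid]; ring

/-- Auxiliary: `d h ≤ T` and `T − h < d h` for `d = ⌊LT/2π⌋₊`, `T > 0`, `L > 0`.
[cite: AlpogeFurman2026, §2.2 (p. 4: "`α_0, …, α_{d−1} ∈ [T, 2T)`")] -/
private theorem gridDim_mul_step {T : ℝ} (hT : 0 < T) (hL : 0 < logHeight T) :
    (gridDim T : ℝ) * (2 * π / logHeight T) ≤ T ∧
      T - 2 * π / logHeight T < (gridDim T : ℝ) * (2 * π / logHeight T) := by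
  have hπ := Real.pi_pos
  have hx : 0 ≤ logHeight T * T / (2 * π) := by positivity
  have h1 : (gridDim T : ℝ) ≤ logHeight T * T / (2 * π) := Nat.floor_le hx
  have h2 : logHeight T * T / (2 * π) < (gridDim T : ℝ) + 1 := Nat.lt_floor_add_one _
  have hh : 0 < 2 * π / logHeight T := by positivity
  constructor
  · calc (gridDim T : ℝ) * (2 * π / logHeight T) ≤ logHeight T * T / (2 * π) * (2 * π / logHeight T) :=
        mul_le_mul_of_nonneg_right h1 hh.le
      _ = T := by field_simp
  · have : (logHeight T * T / (2 * π) - 1) * (2 * π / logHeight T) < (gridDim T : ℝ) * (2 * π / logHeight T) :=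
      mul_lt_mul_of_pos_right (by linarith) hh
    calc T - 2 * π / logHeight T = (logHeight T * T / (2 * π) - 1) * (2 * π / logHeight T) := by field_simp
      _ < (gridDim T : ℝ) * (2 * π / logHeight T) := this


/-- **Per-zero bound, any zero** ("Bound A"): `|Σ_{0≤k<d} φ̂(z − α_k)² − L∫φ²| ≤ (e^{L|Im z|} + 1) L∫φ²`
(the finite Gabor sum of `|φ̂|²` is at most the full one). Used for the `O(L)` zeros within `2` of
`T` or `2T`. [cite: AlpogeFurman2026, Proposition 4.2 (proof), p. 6] -/
theorem norm_sum_sq_hat_sub_le_near (hψ : IsWindow ψ) {T : ℝ} (hL : 0 < logHeight T) (z : ℂ) :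
    ‖∑ k : Fin (gridDim T), hat (fun u ↦ (phi ψ T u : ℂ)) (z - grid T (logHeight T) ((k : ℕ) : ℤ)) ^ 2 -
        ((logHeight T * ∫ u : ℝ, phi ψ T u ^ 2 : ℝ) : ℂ)‖ ≤
      (Real.exp (logHeight T * |z.im|) + 1) * (logHeight T * ∫ u : ℝ, phi ψ T u ^ 2) := by
  classical
  have hM0 : 0 ≤ logHeight T * ∫ u : ℝ, phi ψ T u ^ 2 :=
    mul_nonneg hL.le (integral_nonneg fun u ↦ sq_nonneg _)
  refine (norm_sub_le _ _).trans ?_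
  rw [Complex.norm_real, Real.norm_of_nonneg hM0, add_mul, one_mul]
  refine add_le_add ?_ le_rfl
  refine (norm_sum_le _ _).trans ?_
  simp_rw [norm_pow]
  -- reindex `Fin d` into `ℤ`
  have hinj : ∀ a ∈ (Finset.univ : Finset (Fin (gridDim T))), ∀ b ∈ (Finset.univ : Finset (Fin (gridDim T))),
      (fun k : Fin (gridDim T) ↦ ((k : ℕ) : ℤ)) a = (fun k : Fin (gridDim T) ↦ ((k : ℕ) : ℤ)) b → a = b := by
    intro a _ b _ h
    have h' : ((a : ℕ) : ℤ) = ((b : ℕ) : ℤ) := h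
    exact Fin.ext (by exact_mod_cast h')
  have h := sum_norm_sq_hat_phi_le hψ hL z
    ((Finset.univ : Finset (Fin (gridDim T))).image fun k : Fin (gridDim T) ↦ ((k : ℕ) : ℤ))
  rw [Finset.sum_image hinj] at h
  exact h

/-- **Per-zero bound, outside on the left** (`Re z ≤ T − D`, `D ≥ 1`): the window's own Gabor terms
decay, `Σ_{0≤k<d} |φ̂(z − α_k)|² ≤ C_dec² e^{L|Im z|} (1/D² + L/(2πD))`, hence
`|Σ_{0≤k<d} φ̂(z − α_k)² − L∫φ²| ≤ C_dec² e^{L|Im z|}(1/D² + L/(2πD)) + L∫φ²`.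
[cite: AlpogeFurman2026, Proposition 4.2 (proof), p. 6] -/
theorem norm_sum_sq_hat_sub_le_left (hψ : IsWindow ψ) {B K Kχ : ℝ} (hB0 : 0 ≤ B) (hK0 : 0 ≤ K)
    (hKχ0 : 0 ≤ Kχ) (hB : ∀ x ∈ Icc (-(1 / 2 : ℝ)) (1 / 2), Real.sqrt (ψ x) ≤ B)
    (hK : ∀ a ∈ Icc (-(1 / 2 : ℝ)) (1 / 2), ∀ b ∈ Icc (-(1 / 2 : ℝ)) (1 / 2),
      |Real.sqrt (ψ a) - Real.sqrt (ψ b)| ≤ K * |a - b|)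
    (hKχ : ∀ a b : ℝ, |smoothRamp a - smoothRamp b| ≤ Kχ * |a - b|)
    {T : ℝ} (hL : 10 ≤ logHeight T) {z : ℂ} (hy : |z.im| ≤ 1 / 2) {D : ℝ} (hD : 1 ≤ D)
    (hx : z.re + D ≤ T) :
    ‖∑ k : Fin (gridDim T), hat (fun u ↦ (phi ψ T u : ℂ)) (z - grid T (logHeight T) ((k : ℕ) : ℤ)) ^ 2 -
        ((logHeight T * ∫ u : ℝ, phi ψ T u ^ 2 : ℝ) : ℂ)‖ ≤
      (π / 2 * Real.exp (π / 2) * (B + K + 4 * (1 + π) * Kχ * B)) ^ 2 * Real.exp (logHeight T * |z.im|) *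
        (1 / D ^ 2 + 1 / (2 * π / logHeight T * D)) + logHeight T * ∫ u : ℝ, phi ψ T u ^ 2 := by
  classical
  have hπ := Real.pi_gt_three
  have hL0 : 0 < logHeight T := by linarith
  obtain ⟨hh0, hh1⟩ := grid_step_bounds hL
  set h := 2 * π / logHeight T with hhdef
  set W := (π / 2 * Real.exp (π / 2) * (B + K + 4 * (1 + π) * Kχ * B)) ^ 2 * Real.exp (logHeight T * |z.im|)
    with hW
  have hW0 : 0 ≤ W := by positivity
  have hM0 : 0 ≤ logHeight T * ∫ u : ℝ, phi ψ T u ^ 2 :=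
    mul_nonneg hL0.le (integral_nonneg fun u ↦ sq_nonneg _)
  set D' := T - z.re with hD'
  have hD'D : D ≤ D' := by linarith
  have hD'1 : 1 ≤ D' := hD.trans hD'D
  refine (norm_sub_le _ _).trans ?_
  rw [Complex.norm_real, Real.norm_of_nonneg hM0]
  refine add_le_add ?_ le_rfl
  refine (norm_sum_le _ _).trans ?_
  simp_rw [norm_pow]
  -- termwise decay
  have hterm : ∀ k : Fin (gridDim T),
      ‖hat (fun u ↦ (phi ψ T u : ℂ)) (z - grid T (logHeight T) ((k : ℕ) : ℤ))‖ ^ 2 ≤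
        W / (D' + ((k : ℕ) : ℝ) * h) ^ 2 := by
    intro k
    have hξ : |z.re - grid T (logHeight T) ((k : ℕ) : ℤ)| = D' + ((k : ℕ) : ℕ) * (2 * π / logHeight T) := by
      rw [grid_eq', abs_of_nonpos]
      · push_cast; ring
      · have : 0 ≤ ((k : ℕ) : ℝ) * (2 * π / logHeight T) := by positivity
        push_cast; linarith
    have := norm_sq_hat_phi_grid_le hψ hB0 hK0 hKχ0 hB hK hKχ hL hy hD'1 hξ
    exact this
  refine (Finset.sum_le_sum fun k _ ↦ hterm k).trans ?_
  have hsum : ∑ k : Fin (gridDim T), W / (D' + ((k : ℕ) : ℝ) * h) ^ 2 =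
      W * ∑ j ∈ Finset.range (gridDim T), 1 / (D' + (j : ℝ) * h) ^ 2 := by
    rw [Finset.mul_sum, Fin.sum_univ_eq_sum_range (fun j ↦ W / (D' + (j : ℝ) * h) ^ 2)]
    refine Finset.sum_congr rfl fun j _ ↦ ?_
    ring
  rw [hsum]
  refine mul_le_mul_of_nonneg_left ?_ hW0
  refine (sum_inv_sq_arith_le (by linarith) hh0 _).trans ?_
  have h1 : 1 / D' ^ 2 ≤ 1 / D ^ 2 := by
    apply one_div_le_one_div_of_le (by positivity)
    exact pow_le_pow_left₀ (by linarith) hD'D 2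
  have h2 : 1 / (h * D') ≤ 1 / (h * D) :=
    one_div_le_one_div_of_le (by positivity) (mul_le_mul_of_nonneg_left hD'D hh0.le)
  linarith

/-- **Per-zero bound, outside on the right** (`Re z ≥ 2T + D`, `D ≥ 1`, `T > 0`).
[cite: AlpogeFurman2026, Proposition 4.2 (proof), p. 6] -/
theorem norm_sum_sq_hat_sub_le_right (hψ : IsWindow ψ) {B K Kχ : ℝ} (hB0 : 0 ≤ B) (hK0 : 0 ≤ K)
    (hKχ0 : 0 ≤ Kχ) (hB : ∀ x ∈ Icc (-(1 / 2 : ℝ)) (1 / 2), Real.sqrt (ψ x) ≤ B)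
    (hK : ∀ a ∈ Icc (-(1 / 2 : ℝ)) (1 / 2), ∀ b ∈ Icc (-(1 / 2 : ℝ)) (1 / 2),
      |Real.sqrt (ψ a) - Real.sqrt (ψ b)| ≤ K * |a - b|)
    (hKχ : ∀ a b : ℝ, |smoothRamp a - smoothRamp b| ≤ Kχ * |a - b|)
    {T : ℝ} (hT : 0 < T) (hL : 10 ≤ logHeight T) {z : ℂ} (hy : |z.im| ≤ 1 / 2) {D : ℝ} (hD : 1 ≤ D)
    (hx : 2 * T + D ≤ z.re) :
    ‖∑ k : Fin (gridDim T), hat (fun u ↦ (phi ψ T u : ℂ)) (z - grid T (logHeight T) ((k : ℕ) : ℤ)) ^ 2 -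
        ((logHeight T * ∫ u : ℝ, phi ψ T u ^ 2 : ℝ) : ℂ)‖ ≤
      (π / 2 * Real.exp (π / 2) * (B + K + 4 * (1 + π) * Kχ * B)) ^ 2 * Real.exp (logHeight T * |z.im|) *
        (1 / D ^ 2 + 1 / (2 * π / logHeight T * D)) + logHeight T * ∫ u : ℝ, phi ψ T u ^ 2 := by
  classical
  have hπ := Real.pi_gt_three
  have hL0 : 0 < logHeight T := by linarith
  obtain ⟨hh0, hh1⟩ := grid_step_bounds hL
  obtain ⟨hd1, hd2⟩ := gridDim_mul_step hT hL0
  set h := 2 * π / logHeight T with hhdef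
  set d := gridDim T with hddef
  set W := (π / 2 * Real.exp (π / 2) * (B + K + 4 * (1 + π) * Kχ * B)) ^ 2 * Real.exp (logHeight T * |z.im|)
    with hW
  have hW0 : 0 ≤ W := by positivity
  have hM0 : 0 ≤ logHeight T * ∫ u : ℝ, phi ψ T u ^ 2 :=
    mul_nonneg hL0.le (integral_nonneg fun u ↦ sq_nonneg _)
  -- `D′ = x − T − (d − 1)h ≥ x − 2T + h ≥ D`
  set D' := z.re - T - ((d : ℝ) - 1) * h with hD'
  have hD'D : D ≤ D' := by
    have : ((d : ℝ) - 1) * h ≤ T - h := by nlinarith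
    linarith
  have hD'1 : 1 ≤ D' := hD.trans hD'D
  refine (norm_sub_le _ _).trans ?_
  rw [Complex.norm_real, Real.norm_of_nonneg hM0]
  refine add_le_add ?_ le_rfl
  refine (norm_sum_le _ _).trans ?_
  simp_rw [norm_pow]
  have hterm : ∀ k : Fin d,
      ‖hat (fun u ↦ (phi ψ T u : ℂ)) (z - grid T (logHeight T) ((k : ℕ) : ℤ))‖ ^ 2 ≤
        W / (D' + ((d - 1 - (k : ℕ) : ℕ) : ℝ) * h) ^ 2 := by
    intro k
    have hk : (k : ℕ) ≤ d - 1 := Nat.le_sub_one_of_lt k.2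
    have hd0 : 1 ≤ d := Nat.one_le_of_lt k.2
    have hcast : ((d - 1 - (k : ℕ) : ℕ) : ℝ) = (d : ℝ) - 1 - (k : ℕ) := by
      rw [Nat.cast_sub hk, Nat.cast_sub hd0]; push_cast; ring
    have hξ : |z.re - grid T (logHeight T) ((k : ℕ) : ℤ)| = D' + ((d - 1 - (k : ℕ) : ℕ) : ℕ) * (2 * π / logHeight T) := by
      rw [grid_eq', abs_of_nonneg]
      · push_cast
        rw [hcast, hD', hhdef]; ring
      · have : ((k : ℕ) : ℝ) * h ≤ ((d : ℝ) - 1) * h := by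
          refine mul_le_mul_of_nonneg_right ?_ hh0.le
          have : ((k : ℕ) : ℝ) ≤ ((d - 1 : ℕ) : ℝ) := by exact_mod_cast hk
          rw [Nat.cast_sub hd0] at this; push_cast at this; exact this
        push_cast
        have e : ((k : ℕ) : ℝ) * (2 * π / logHeight T) = ((k : ℕ) : ℝ) * h := by rw [hhdef]
        rw [e]
        linarith
    have := norm_sq_hat_phi_grid_le hψ hB0 hK0 hKχ0 hB hK hKχ hL hy hD'1 hξ
    exact this
  refine (Finset.sum_le_sum fun k _ ↦ hterm k).trans ?_
  have hsum : ∑ k : Fin d, W / (D' + ((d - 1 - (k : ℕ) : ℕ) : ℝ) * h) ^ 2 =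
      W * ∑ j ∈ Finset.range d, 1 / (D' + (j : ℝ) * h) ^ 2 := by
    rw [Finset.mul_sum, Fin.sum_univ_eq_sum_range (fun j ↦ W / (D' + ((d - 1 - j : ℕ) : ℝ) * h) ^ 2),
      ← Finset.sum_range_reflect (fun j ↦ W * (1 / (D' + (j : ℝ) * h) ^ 2)) d]
    refine Finset.sum_congr rfl fun j _ ↦ ?_
    ring
  rw [hsum]
  refine mul_le_mul_of_nonneg_left ?_ hW0
  refine (sum_inv_sq_arith_le (by linarith) hh0 _).trans ?_
  have h1 : 1 / D' ^ 2 ≤ 1 / D ^ 2 := by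
    apply one_div_le_one_div_of_le (by positivity)
    exact pow_le_pow_left₀ (by linarith) hD'D 2
  have h2 : 1 / (h * D') ≤ 1 / (h * D) :=
    one_div_le_one_div_of_le (by positivity) (mul_le_mul_of_nonneg_left hD'D hh0.le)
  linarith


/-- Membership in the index window `{0, …, d−1} ⊂ ℤ`. [folklore] -/
private theorem mem_image_fin_iff {d : ℕ} {k : ℤ} :
    k ∈ (Finset.univ : Finset (Fin d)).image (fun j : Fin d ↦ ((j : ℕ) : ℤ)) ↔ 0 ≤ k ∧ k < d := by
  rw [Finset.mem_image]
  constructor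
  · rintro ⟨j, -, rfl⟩
    exact ⟨by positivity, by exact_mod_cast j.2⟩
  · rintro ⟨h0, h1⟩
    refine ⟨⟨k.toNat, by omega⟩, Finset.mem_univ _, ?_⟩
    simp only
    omega

set_option maxHeartbeats 400000 in
/-- **Per-zero bound, inside the window** ("Bound B"; `T + D ≤ Re z ≤ 2T − D`, `D ≥ 2`): only the
grid points with `k ∉ [0, d)` are missing from the full Gabor sum, and they are at distance `≥ D − h`
from `Re z`, so `|Σ_{0≤k<d} φ̂(z − α_k)² − L∫φ²| = |Σ_{k∉[0,d)} φ̂(z − α_k)²|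
≤ C_dec² e^{L|Im z|} (5/D² + 3/(hD))` (two arithmetic progressions, `h = 2π/L`). This is the printed
"`Σ_{k∉[0,d)} |Re γ_ρ − α_k|^{-4} … ≪ L min(L³, D_ρ^{-3})`" step with first-order decay.
[cite: AlpogeFurman2026, Proposition 4.2 (proof), p. 6] -/
theorem norm_sum_sq_hat_sub_le_inside (hψ : IsWindow ψ) {B K Kχ : ℝ} (hB0 : 0 ≤ B) (hK0 : 0 ≤ K)
    (hKχ0 : 0 ≤ Kχ) (hB : ∀ x ∈ Icc (-(1 / 2 : ℝ)) (1 / 2), Real.sqrt (ψ x) ≤ B)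
    (hK : ∀ a ∈ Icc (-(1 / 2 : ℝ)) (1 / 2), ∀ b ∈ Icc (-(1 / 2 : ℝ)) (1 / 2),
      |Real.sqrt (ψ a) - Real.sqrt (ψ b)| ≤ K * |a - b|)
    (hKχ : ∀ a b : ℝ, |smoothRamp a - smoothRamp b| ≤ Kχ * |a - b|)
    {T : ℝ} (hT : 0 < T) (hL : 10 ≤ logHeight T) {z : ℂ} (hy : |z.im| ≤ 1 / 2) {D : ℝ} (hD : 2 ≤ D)
    (hx1 : T + D ≤ z.re) (hx2 : z.re + D ≤ 2 * T) :
    ‖∑ k : Fin (gridDim T), hat (fun u ↦ (phi ψ T u : ℂ)) (z - grid T (logHeight T) ((k : ℕ) : ℤ)) ^ 2 -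
        ((logHeight T * ∫ u : ℝ, phi ψ T u ^ 2 : ℝ) : ℂ)‖ ≤
      (π / 2 * Real.exp (π / 2) * (B + K + 4 * (1 + π) * Kχ * B)) ^ 2 * Real.exp (logHeight T * |z.im|) *
        (5 / D ^ 2 + 3 / (2 * π / logHeight T * D)) := by
  classical
  have hπ := Real.pi_gt_three
  have hL0 : 0 < logHeight T := by linarith
  obtain ⟨hh0, hh1⟩ := grid_step_bounds hL
  obtain ⟨hd1, hd2⟩ := gridDim_mul_step hT hL0
  set h := 2 * π / logHeight T with hhdef
  set d := gridDim T with hddef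
  set W := (π / 2 * Real.exp (π / 2) * (B + K + 4 * (1 + π) * Kχ * B)) ^ 2 * Real.exp (logHeight T * |z.im|)
    with hW
  have hW0 : 0 ≤ W := by positivity
  set f : ℤ → ℂ := fun k ↦ hat (fun u ↦ (phi ψ T u : ℂ)) (z - grid T (logHeight T) k) ^ 2 with hf
  set F : ℤ → ℝ := fun k ↦ ‖hat (fun u ↦ (phi ψ T u : ℂ)) (z - grid T (logHeight T) k)‖ ^ 2 with hFdef
  have hfs : HasSum f ((logHeight T * ∫ u : ℝ, phi ψ T u ^ 2 : ℝ) : ℂ) := hasSum_sq_hat_phi hψ hL0 z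
  have hFs : Summable F := (hasSum_norm_sq_hat_phi hψ hL0 z).summable
  have hnorm : ∀ k, ‖f k‖ = F k := fun k ↦ by simp [hf, hFdef, norm_pow]
  set Kset := (Finset.univ : Finset (Fin d)).image (fun j : Fin d ↦ ((j : ℕ) : ℤ)) with hKset
  -- the finite window sum as a sum over `Kset`
  have hinj : ∀ a ∈ (Finset.univ : Finset (Fin d)), ∀ b ∈ (Finset.univ : Finset (Fin d)),
      (fun k : Fin d ↦ ((k : ℕ) : ℤ)) a = (fun k : Fin d ↦ ((k : ℕ) : ℤ)) b → a = b := by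
    intro a _ b _ hab
    have h' : ((a : ℕ) : ℤ) = ((b : ℕ) : ℤ) := hab
    exact Fin.ext (by exact_mod_cast h')
  have hwin : ∑ k : Fin d, hat (fun u ↦ (phi ψ T u : ℂ)) (z - grid T (logHeight T) ((k : ℕ) : ℤ)) ^ 2 =
      ∑ k ∈ Kset, f k := by
    rw [hKset, Finset.sum_image hinj]
  -- complement identity
  have hcompl : ∑ k ∈ Kset, f k + ∑' k : ↥((↑Kset : Set ℤ)ᶜ), f k =
      ((logHeight T * ∫ u : ℝ, phi ψ T u ^ 2 : ℝ) : ℂ) := by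
    rw [hfs.summable.sum_add_tsum_compl, hfs.tsum_eq]
  have hE : ∑ k ∈ Kset, f k - ((logHeight T * ∫ u : ℝ, phi ψ T u ^ 2 : ℝ) : ℂ) =
      -∑' k : ↥((↑Kset : Set ℤ)ᶜ), f k := by
    rw [← hcompl]; ring
  rw [hwin, hE, norm_neg]
  -- `‖Σ' f‖ ≤ Σ' ‖f‖ = Σ' F` over the complement
  have hsumN : Summable fun i : ↥((↑Kset : Set ℤ)ᶜ) ↦ ‖f i‖ := by
    have := hFs.subtype ((↑Kset : Set ℤ)ᶜ)
    refine this.congr fun i ↦ ?_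
    simp [Function.comp, hnorm]
  refine (norm_tsum_le_tsum_norm hsumN).trans ?_
  simp_rw [hnorm]
  refine Real.tsum_le_of_sum_le (fun _ ↦ sq_nonneg _) fun u ↦ ?_
  -- a finite set of indices outside `[0, d)`
  set u' : Finset ℤ := u.map (Function.Embedding.subtype _) with hu'
  have hsum_u : ∑ i ∈ u, F (i : ℤ) = ∑ k ∈ u', F k := by
    rw [hu', Finset.sum_map]; rfl
  have hout : ∀ k ∈ u', k < 0 ∨ (d : ℤ) ≤ k := by
    intro k hk
    rw [hu', Finset.mem_map] at hk
    obtain ⟨i, -, rfl⟩ := hk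
    have hi : ¬(0 ≤ (i : ℤ) ∧ (i : ℤ) < (d : ℤ)) := fun hc ↦
      i.2 (Finset.mem_coe.2 (mem_image_fin_iff.2 hc))
    simp only [Function.Embedding.coe_subtype]
    omega
  rw [hsum_u, ← Finset.sum_filter_add_sum_filter_not u' (fun k ↦ k < 0)]
  -- negative indices: `x − α_k = (x − T + h) + j h`, `j = −k − 1`
  have hneg : ∑ k ∈ u'.filter (fun k ↦ k < 0), F k ≤ W * (1 / D ^ 2 + 1 / (h * D)) := by
    set D₁ := z.re - T + h with hD₁
    have hD₁D : D ≤ D₁ := by linarith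
    have hD₁1 : 1 ≤ D₁ := by linarith
    have hterm : ∀ k ∈ u'.filter (fun k ↦ k < 0),
        F k ≤ W / (D₁ + (((-k - 1).toNat : ℕ) : ℝ) * h) ^ 2 := by
      intro k hk
      rw [Finset.mem_filter] at hk
      have hk0 : k < 0 := hk.2
      have hcast : (((-k - 1).toNat : ℕ) : ℝ) = -(k : ℝ) - 1 := by
        have : ((-k - 1).toNat : ℤ) = -k - 1 := Int.toNat_of_nonneg (by omega)
        exact_mod_cast this
      have hξ : |z.re - grid T (logHeight T) k| = D₁ + (((-k - 1).toNat : ℕ) : ℕ) * (2 * π / logHeight T) := by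
        rw [grid_eq', abs_of_nonneg]
        · rw [hcast, hD₁, hhdef]; ring
        · have : (k : ℝ) * (2 * π / logHeight T) ≤ 0 :=
            mul_nonpos_of_nonpos_of_nonneg (by exact_mod_cast hk0.le) hh0.le
          linarith
      have := norm_sq_hat_phi_grid_le hψ hB0 hK0 hKχ0 hB hK hKχ hL hy hD₁1 hξ
      exact this
    refine (Finset.sum_le_sum hterm).trans ?_
    have hinjι : Set.InjOn (fun k : ℤ ↦ (-k - 1).toNat) ↑(u'.filter (fun k ↦ k < 0)) := by
      intro a ha b hb hab
      rw [Finset.coe_filter] at ha hb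
      have ha' : a < 0 := ha.2
      have hb' : b < 0 := hb.2
      have : ((-a - 1).toNat : ℤ) = ((-b - 1).toNat : ℤ) := by exact_mod_cast hab
      rw [Int.toNat_of_nonneg (by omega), Int.toNat_of_nonneg (by omega)] at this
      omega
    have hs := sum_inv_sq_reindex_le hinjι (by linarith : 0 < D₁) hh0
    calc ∑ k ∈ u'.filter (fun k ↦ k < 0), W / (D₁ + (((-k - 1).toNat : ℕ) : ℝ) * h) ^ 2
        = W * ∑ k ∈ u'.filter (fun k ↦ k < 0), 1 / (D₁ + (((-k - 1).toNat : ℕ) : ℝ) * h) ^ 2 := by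
          rw [Finset.mul_sum]; refine Finset.sum_congr rfl fun k _ ↦ ?_; ring
      _ ≤ W * (1 / D₁ ^ 2 + 1 / (h * D₁)) := mul_le_mul_of_nonneg_left hs hW0
      _ ≤ W * (1 / D ^ 2 + 1 / (h * D)) := by
          refine mul_le_mul_of_nonneg_left ?_ hW0
          have h1 : 1 / D₁ ^ 2 ≤ 1 / D ^ 2 := by
            apply one_div_le_one_div_of_le (by positivity)
            exact pow_le_pow_left₀ (by linarith) hD₁D 2
          have h2 : 1 / (h * D₁) ≤ 1 / (h * D) :=
            one_div_le_one_div_of_le (by positivity) (mul_le_mul_of_nonneg_left hD₁D hh0.le)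
          linarith
  -- indices `k ≥ d`: `α_k − x = (T + d h − x) + j h`, `j = k − d`
  have hpos : ∑ k ∈ u'.filter (fun k ↦ ¬k < 0), F k ≤ W * (4 / D ^ 2 + 2 / (h * D)) := by
    set c₀ := T + (d : ℝ) * h - z.re with hc₀
    have hc₀D : D / 2 ≤ c₀ := by
      have : (2 : ℝ) * T - z.re ≥ D := by linarith
      linarith
    have hc₀1 : 1 ≤ c₀ := by linarith
    have hterm : ∀ k ∈ u'.filter (fun k ↦ ¬k < 0),
        F k ≤ W / (c₀ + (((k - d).toNat : ℕ) : ℝ) * h) ^ 2 := by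
      intro k hk
      rw [Finset.mem_filter] at hk
      have hkd : (d : ℤ) ≤ k := (hout k hk.1).resolve_left hk.2
      have hcast : (((k - d).toNat : ℕ) : ℝ) = (k : ℝ) - d := by
        have : ((k - d).toNat : ℤ) = k - d := Int.toNat_of_nonneg (by omega)
        exact_mod_cast this
      have hξ : |z.re - grid T (logHeight T) k| = c₀ + (((k - d).toNat : ℕ) : ℕ) * (2 * π / logHeight T) := by
        rw [grid_eq', abs_of_nonpos]
        · rw [hcast, hc₀, hhdef]; ring
        · have hkd' : (d : ℝ) ≤ (k : ℝ) := by exact_mod_cast hkd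
          have : (d : ℝ) * h ≤ (k : ℝ) * (2 * π / logHeight T) := by
            rw [← hhdef]; exact mul_le_mul_of_nonneg_right hkd' hh0.le
          linarith
      have := norm_sq_hat_phi_grid_le hψ hB0 hK0 hKχ0 hB hK hKχ hL hy hc₀1 hξ
      exact this
    refine (Finset.sum_le_sum hterm).trans ?_
    have hinjι : Set.InjOn (fun k : ℤ ↦ (k - d).toNat) ↑(u'.filter (fun k ↦ ¬k < 0)) := by
      intro a ha b hb hab
      rw [Finset.coe_filter] at ha hb
      have ha' : (d : ℤ) ≤ a := (hout a ha.1).resolve_left ha.2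
      have hb' : (d : ℤ) ≤ b := (hout b hb.1).resolve_left hb.2
      have : ((a - d).toNat : ℤ) = ((b - d).toNat : ℤ) := by exact_mod_cast hab
      rw [Int.toNat_of_nonneg (by omega), Int.toNat_of_nonneg (by omega)] at this
      omega
    have hs := sum_inv_sq_reindex_le hinjι (by linarith : 0 < c₀) hh0
    calc ∑ k ∈ u'.filter (fun k ↦ ¬k < 0), W / (c₀ + (((k - d).toNat : ℕ) : ℝ) * h) ^ 2
        = W * ∑ k ∈ u'.filter (fun k ↦ ¬k < 0), 1 / (c₀ + (((k - d).toNat : ℕ) : ℝ) * h) ^ 2 := by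
          rw [Finset.mul_sum]; refine Finset.sum_congr rfl fun k _ ↦ ?_; ring
      _ ≤ W * (1 / c₀ ^ 2 + 1 / (h * c₀)) := mul_le_mul_of_nonneg_left hs hW0
      _ ≤ W * (4 / D ^ 2 + 2 / (h * D)) := by
          refine mul_le_mul_of_nonneg_left ?_ hW0
          have hD0 : 0 < D := by linarith
          have h1 : 1 / c₀ ^ 2 ≤ 4 / D ^ 2 := by
            rw [div_le_div_iff₀ (by positivity) (by positivity)]
            nlinarith [mul_pos hD0 hD0]
          have h2 : 1 / (h * c₀) ≤ 2 / (h * D) := by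
            rw [div_le_div_iff₀ (by positivity) (by positivity)]
            nlinarith
          linarith
  have : W * (1 / D ^ 2 + 1 / (h * D)) + W * (4 / D ^ 2 + 2 / (h * D)) = W * (5 / D ^ 2 + 3 / (h * D)) := by
    ring
  linarith


/-! ## §6. Zero bookkeeping: short windows, the normalisation `M = aL² ≍ L²`, the trace formula -/

/-- `log 2π ≤ 2`. [folklore] -/
private theorem log_two_pi_le_two' : Real.log (2 * π) ≤ 2 := by
  rw [Real.log_le_iff_le_exp (by positivity)]
  have h1 := Real.exp_one_gt_d9
  have h2 : Real.exp 2 = Real.exp 1 * Real.exp 1 := by rw [← Real.exp_add]; norm_num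
  nlinarith [Real.pi_lt_d4]

/-- **Short-window zero count near height `T`**: for `L = log(T/2π) ≥ 10`, `2π ≤ t` and `t + 2 ≤ 4T`,
`N(t+2) − N(t) ≤ 30 L` (explicit Riemann–von Mangoldt, `zetaZeroCount_window_le_nine`). This is the
"`N(t, t+1) ≪ log t`" / "density `≪ L`" of [AF26] Propositions 4.2–4.3.
[cite: AlpogeFurman2026, Proposition 4.2 (proof, "density `≪ L`"), p. 6] -/
theorem window_two_le {T t : ℝ} (hL : 10 ≤ logHeight T) (ht : 2 * π ≤ t) (ht4 : t + 2 ≤ 4 * T) :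
    (zetaZeroCount (t + 2) : ℝ) - zetaZeroCount t ≤ 30 * logHeight T := by
  have hπ := Real.pi_gt_three
  have hπ4 := Real.pi_lt_d4
  have ht0 : 0 < t := by linarith
  have hT0 : 0 < T := by linarith
  have h := zetaZeroCount_window_le_nine ht (by norm_num : (0 : ℝ) ≤ 2)
  set L := logHeight T with hLdef
  -- logarithms at height `≤ 4T`
  have hlog4T : Real.log (4 * T) ≤ L + 4 := by
    rw [Real.log_mul (by norm_num) hT0.ne', log_eq_logHeight_add hT0]
    have : Real.log 4 ≤ 2 := by
      have := Real.log_le_sub_one_of_pos (by norm_num : (0 : ℝ) < 4)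
      rw [show (4 : ℝ) = 2 * 2 by norm_num, Real.log_mul (by norm_num) (by norm_num)]
      linarith [Real.log_two_lt_d9]
    linarith [log_two_pi_le_two']
  have h1 : Real.log ((t + 2) / (2 * π)) ≤ L + 4 := by
    calc Real.log ((t + 2) / (2 * π)) ≤ Real.log (4 * T) := by
          refine Real.log_le_log (by positivity) ?_
          rw [div_le_iff₀ (by positivity)]; nlinarith
      _ ≤ L + 4 := hlog4T
  have h2 : Real.log (t + 2) ≤ L + 4 := (Real.log_le_log (by linarith) ht4).trans hlog4T
  have h3 : Real.log t ≤ L + 4 := (Real.log_le_log ht0 (by linarith)).trans hlog4T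
  have h4 : 2 * Real.log ((t + 2) / (2 * π)) / (2 * π) ≤ (L + 4) / 3 := by
    rw [div_le_div_iff₀ (by positivity) (by norm_num)]
    have : 0 ≤ L + 4 := by linarith
    nlinarith [Real.log_nonneg (show (1 : ℝ) ≤ (t + 2) / (2 * π) by
      rw [le_div_iff₀ (by positivity)]; linarith)]
  linarith

/-- **The normalisation is of size `L²`**: for a window with floor `m₀` on `[−½,½]` and `L ≥ 4`,
`M := L ∫ φ² = aL² ≥ m₀ L²/2` (`φ² = ψ(u/L) ≥ m₀` on `|u| ≤ L/2 − 1`, where the ramps are `1`).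
[cite: AlpogeFurman2026, §2.3 (p. 4: "`a = ∫ψ + O_χ(L⁻¹)`")] -/
theorem normalisation_ge (hψ : IsWindow ψ) {m₀ : ℝ} (hm₀ : 0 < m₀)
    (hfloor : ∀ x ∈ Icc (-(1 / 2 : ℝ)) (1 / 2), m₀ ≤ ψ x) {T : ℝ} (hL : 4 ≤ logHeight T) :
    m₀ * logHeight T ^ 2 / 2 ≤ logHeight T * ∫ u : ℝ, phi ψ T u ^ 2 := by
  set L := logHeight T with hLdef
  have hL0 : 0 < L := by linarith
  -- `φ² ≥ m₀` on the bulk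
  have hbulk : ∀ u ∈ Icc (-(L / 2 - 1)) (L / 2 - 1), m₀ ≤ phi ψ T u ^ 2 := by
    intro u hu
    have hu' : |u| ≤ L / 2 - 1 := abs_le.2 ⟨hu.1, hu.2⟩
    rw [phi, ← hLdef, smoothRamp_of_one_le (by rw [abs_le] at hu'; linarith),
      smoothRamp_of_one_le (by rw [abs_le] at hu'; linarith), one_mul, one_mul,
      Real.sq_sqrt (hm₀.le.trans (hfloor _ (clampHalf_mem _)))]
    exact hfloor _ (clampHalf_mem _)
  have hint : ∫ u : ℝ, (Icc (-(L / 2 - 1)) (L / 2 - 1)).indicator (fun _ ↦ m₀) u ≤ ∫ u : ℝ, phi ψ T u ^ 2 := by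
    refine integral_mono_of_nonneg (Eventually.of_forall fun u ↦ Set.indicator_nonneg (fun _ _ ↦ hm₀.le) u) ?_
      (Eventually.of_forall fun u ↦ ?_)
    · have hK2 : HasCompactSupport fun u : ℝ ↦ phi ψ T u ^ 2 := by
        have h := (hasCompactSupport_phi ψ T).mul_right (f' := phi ψ T)
        have e : (fun u : ℝ ↦ phi ψ T u ^ 2) = phi ψ T * phi ψ T := by
          funext u; simp [pow_two]
        rw [e]; exact h
      exact ((hψ.continuous_phi T).pow 2).integrable_of_hasCompactSupport hK2
    · dsimp only
      by_cases hu : u ∈ Icc (-(L / 2 - 1)) (L / 2 - 1)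
      · rw [indicator_of_mem hu]; exact hbulk u hu
      · rw [indicator_of_notMem hu]; exact sq_nonneg _
  rw [integral_indicator_const _ measurableSet_Icc, Real.volume_real_Icc_of_le (by linarith), smul_eq_mul] at hint
  have : m₀ * L ^ 2 / 2 ≤ L * ((L / 2 - 1 - -(L / 2 - 1)) * m₀) := by
    nlinarith [mul_nonneg (mul_nonneg hm₀.le hL0.le) (sub_nonneg.2 hL)]
  exact this.trans (mul_le_mul_of_nonneg_left hint hL0.le)

/-- `aL² = L∫φ² = M`, so the normalising scalar is `(aL²)⁻¹ = M⁻¹` (`L ≠ 0`).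
[cite: AlpogeFurman2026, §2.3 eq. (2.11) (p. 4)] -/
theorem gramWeight_eq_inv (ψ : ℝ → ℝ) {T : ℝ} (hL : logHeight T ≠ 0) :
    gramWeight ψ T = (((logHeight T * ∫ u : ℝ, phi ψ T u ^ 2 : ℝ)) : ℂ)⁻¹ := by
  rw [gramWeight]
  congr 2
  rw [aConst]
  field_simp

/-- **The trace of `G̃` in closed form**: `tr G̃ = M⁻¹ Σ_{ρ} m_ρ Σ_{0≤k<d} φ̂(γ_ρ − α_k)²`
(`tr(v vᵀ) = Σ_k v_k²`). [cite: AlpogeFurman2026, Proposition 4.2 (proof: "`tr(v_ρ v_ρᵀ) = …`"), p. 6] -/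
theorem trace_gramMatrix_eq (ψ : ℝ → ℝ) (T : ℝ) :
    (gramMatrix ψ T).trace = gramWeight ψ T * ∑ ρ ∈ nearZeroFinset T, (riemannZetaZeroOrder ρ : ℂ) *
      ∑ k : Fin (gridDim T), hat (fun u ↦ (phi ψ T u : ℂ))
        (gammaOf ρ - grid T (logHeight T) ((k : ℕ) : ℤ)) ^ 2 := by
  rw [gramMatrix_eq_sum, trace_smul, trace_sum, smul_eq_mul]
  congr 1
  refine Finset.sum_congr rfl fun ρ _ ↦ ?_
  rw [trace_smul, smul_eq_mul, trace_vecMulVec, dotProduct]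
  congr 1
  refine Finset.sum_congr rfl fun k _ ↦ ?_
  rw [zeroVec, pow_two]


/-! ## §7. The zero sums: near zeros `≪ L`, far zeros `Σ m_ρ/D_ρ ≪ L²`

Here `D_ρ := min(|γ − T|, |γ − 2T|)` is the distance of the ordinate to the nearer endpoint of the
dyadic window; "near" means `D_ρ < 2`. -/

/-- Mass of a length-`2` window at height `≤ 4T`: `Σ_{t < γ ≤ t+2} m_ρ ≤ 30 L`.
[cite: AlpogeFurman2026, Proposition 4.2 (proof), p. 6] -/
theorem sum_zerosBetween_two_le {T t : ℝ} (hL : 10 ≤ logHeight T) (ht : 2 * π ≤ t)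
    (ht4 : t + 2 ≤ 4 * T) :
    ∑ ρ ∈ SchoenfeldBound.zerosBetween t (t + 2), (riemannZetaZeroOrder ρ : ℝ) ≤ 30 * logHeight T := by
  rw [← SchoenfeldBound.zetaZeroCount_sub_eq_sum (by linarith)]
  exact window_two_le hL ht ht4

/-- Union bound for sums of non-negative terms. [folklore] -/
private theorem sum_union_le_add {s t : Finset ℂ} {f : ℂ → ℝ} (h : ∀ x ∈ s ∪ t, 0 ≤ f x) :
    ∑ x ∈ s ∪ t, f x ≤ ∑ x ∈ s, f x + ∑ x ∈ t, f x := by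
  classical
  rw [← Finset.sum_union_inter]
  have : 0 ≤ ∑ x ∈ s ∩ t, f x :=
    Finset.sum_nonneg fun x hx ↦ h x (Finset.mem_union_left _ (Finset.mem_inter.1 hx).1)
  linarith

/-- A set of zeros covered by four length-`2` windows at heights in `[2π, 4T]` has mass `≤ 120 L`.
[folklore] -/
private theorem sum_le_of_subset_four {T : ℝ} (hL : 10 ≤ logHeight T) {A : Finset ℂ}
    {t₁ t₂ t₃ t₄ : ℝ} (h₁ : 2 * π ≤ t₁) (h₁' : t₁ + 2 ≤ 4 * T) (h₂ : 2 * π ≤ t₂)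
    (h₂' : t₂ + 2 ≤ 4 * T) (h₃ : 2 * π ≤ t₃) (h₃' : t₃ + 2 ≤ 4 * T) (h₄ : 2 * π ≤ t₄)
    (h₄' : t₄ + 2 ≤ 4 * T)
    (hsub : A ⊆ SchoenfeldBound.zerosBetween t₁ (t₁ + 2) ∪ SchoenfeldBound.zerosBetween t₂ (t₂ + 2) ∪
      SchoenfeldBound.zerosBetween t₃ (t₃ + 2) ∪ SchoenfeldBound.zerosBetween t₄ (t₄ + 2)) :
    ∑ ρ ∈ A, (riemannZetaZeroOrder ρ : ℝ) ≤ 120 * logHeight T := by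
  classical
  have hπ := Real.pi_gt_three
  set W₁ := SchoenfeldBound.zerosBetween t₁ (t₁ + 2)
  set W₂ := SchoenfeldBound.zerosBetween t₂ (t₂ + 2)
  set W₃ := SchoenfeldBound.zerosBetween t₃ (t₃ + 2)
  set W₄ := SchoenfeldBound.zerosBetween t₄ (t₄ + 2)
  have hnn : ∀ ρ ∈ W₁ ∪ W₂ ∪ W₃ ∪ W₄, (0 : ℝ) ≤ riemannZetaZeroOrder ρ := by
    intro ρ hρ
    simp only [Finset.mem_union] at hρ
    rcases hρ with ((h | h) | h) | h
    · exact SchoenfeldBound.zeroOrder_nonneg_of_mem_zerosBetween (by linarith) h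
    · exact SchoenfeldBound.zeroOrder_nonneg_of_mem_zerosBetween (by linarith) h
    · exact SchoenfeldBound.zeroOrder_nonneg_of_mem_zerosBetween (by linarith) h
    · exact SchoenfeldBound.zeroOrder_nonneg_of_mem_zerosBetween (by linarith) h
  have b₁ := sum_zerosBetween_two_le hL h₁ h₁'
  have b₂ := sum_zerosBetween_two_le hL h₂ h₂'
  have b₃ := sum_zerosBetween_two_le hL h₃ h₃'
  have b₄ := sum_zerosBetween_two_le hL h₄ h₄'
  have s0 := Finset.sum_le_sum_of_subset_of_nonneg hsub fun ρ hρ _ ↦ hnn ρ hρ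
  have s1 := sum_union_le_add hnn
  have s2 := sum_union_le_add (s := W₁ ∪ W₂) (t := W₃) (f := fun ρ ↦ (riemannZetaZeroOrder ρ : ℝ))
    fun ρ hρ ↦ hnn ρ (Finset.mem_union_left _ hρ)
  have s3 := sum_union_le_add (s := W₁) (t := W₂) (f := fun ρ ↦ (riemannZetaZeroOrder ρ : ℝ))
    fun ρ hρ ↦ hnn ρ (Finset.mem_union_left _ (Finset.mem_union_left _ hρ))
  linarith

/-- Elementary facts at a large height: `17 ≤ √T ≤ T/17` for `T ≥ 300`. [folklore] -/
private theorem sqrt_facts {T : ℝ} (hT : 300 ≤ T) : 17 ≤ Real.sqrt T ∧ Real.sqrt T ≤ T / 17 := by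
  have hT0 : 0 < T := by linarith
  have hs17 : 17 ≤ Real.sqrt T := by
    rw [show (17 : ℝ) = Real.sqrt (17 ^ 2) by rw [Real.sqrt_sq (by norm_num)]]
    exact Real.sqrt_le_sqrt (by nlinarith)
  have hsT : Real.sqrt T * Real.sqrt T = T := Real.mul_self_sqrt hT0.le
  exact ⟨hs17, by rw [le_div_iff₀ (by norm_num)]; nlinarith⟩

/-- **Near zeros have mass `≪ L`**: `Σ_{ρ : D_ρ < 2} m_ρ ≤ 120 L` (`T ≥ 300`, `L ≥ 10`).
[cite: AlpogeFurman2026, Proposition 4.2 (proof: "the zeros in a bounded neighbourhood of the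
endpoints contribute `O(√X L)`"), p. 6] -/
theorem sum_near_le {T : ℝ} (hT : 300 ≤ T) (hL : 10 ≤ logHeight T) :
    ∑ ρ ∈ (nearZeroFinset T).filter (fun ρ ↦ min |ρ.im - T| |ρ.im - 2 * T| < 2),
      (riemannZetaZeroOrder ρ : ℝ) ≤ 120 * logHeight T := by
  classical
  have hπ := Real.pi_gt_three
  have hπ4 := Real.pi_lt_d4
  refine sum_le_of_subset_four hL (t₁ := T - 2) (t₂ := T) (t₃ := 2 * T - 2) (t₄ := 2 * T)
    (by linarith) (by linarith) (by linarith) (by linarith) (by linarith) (by linarith) (by linarith)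
    (by linarith) ?_
  intro ρ hρ
  rw [Finset.mem_filter, mem_nearZeroFinset] at hρ
  obtain ⟨⟨hz, h0, h1, -, -⟩, hmin⟩ := hρ
  simp only [Finset.mem_union, SchoenfeldBound.mem_zerosBetween (show (0 : ℝ) ≤ T - 2 by linarith),
    SchoenfeldBound.mem_zerosBetween (show (0 : ℝ) ≤ T by linarith),
    SchoenfeldBound.mem_zerosBetween (show (0 : ℝ) ≤ 2 * T - 2 by linarith),
    SchoenfeldBound.mem_zerosBetween (show (0 : ℝ) ≤ 2 * T by linarith)]
  rcases min_lt_iff.1 hmin with h | h <;> rw [abs_lt] at h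
  · rcases le_or_gt ρ.im T with hle | hlt
    · exact Or.inl (Or.inl (Or.inl ⟨hz, h0, h1, by linarith, by linarith⟩))
    · exact Or.inl (Or.inl (Or.inr ⟨hz, h0, h1, hlt, by linarith⟩))
  · rcases le_or_gt ρ.im (2 * T) with hle | hlt
    · exact Or.inl (Or.inr ⟨hz, h0, h1, by linarith, by linarith⟩)
    · exact Or.inr ⟨hz, h0, h1, hlt, by linarith⟩

/-- **Each distance layer has mass `≪ L`**: the zeros of the window with `⌊D_ρ⌋ = j` (`1 ≤ j ≤ 2T`)
carry mass `≤ 120 L` (four windows of length `2`). [cite: AlpogeFurman2026, Proposition 4.2 (proof: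
"summing ... against the density `≪ L` of zeros"), p. 6] -/
theorem sum_layer_le {T : ℝ} (hT : 300 ≤ T) (hL : 10 ≤ logHeight T) {j : ℕ} (hj : 1 ≤ j)
    (hj' : (j : ℝ) ≤ 2 * T) :
    ∑ ρ ∈ (nearZeroFinset T).filter (fun ρ ↦ ⌊min |ρ.im - T| |ρ.im - 2 * T|⌋₊ = j),
      (riemannZetaZeroOrder ρ : ℝ) ≤ 120 * logHeight T := by
  classical
  have hπ := Real.pi_gt_three
  have hπ4 := Real.pi_lt_d4
  obtain ⟨hs17, hsle⟩ := sqrt_facts hT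
  have hj1 : (1 : ℝ) ≤ j := by exact_mod_cast hj
  set s := Real.sqrt T with hsdef
  -- the four windows
  refine sum_le_of_subset_four hL (t₁ := T + j - 1) (t₂ := max (T - j - 2) (T - s - 3))
    (t₃ := min (2 * T + j - 1) (2 * T + s)) (t₄ := max (2 * T - j - 2) (T - s - 3))
    (by linarith) (by linarith) ((show 2 * π ≤ T - s - 3 by linarith).trans (le_max_right _ _))
    (by linarith [max_le (show T - j - 2 ≤ T by linarith) (show T - s - 3 ≤ T by linarith)])
    (le_min (by linarith) (by linarith)) (by linarith [min_le_right (2 * T + j - 1) (2 * T + s)])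
    ((show 2 * π ≤ T - s - 3 by linarith).trans (le_max_right _ _))
    (by linarith [max_le (show 2 * T - j - 2 ≤ 2 * T by linarith) (show T - s - 3 ≤ 2 * T by linarith)])
    ?_
  intro ρ hρ
  rw [Finset.mem_filter, mem_nearZeroFinset] at hρ
  obtain ⟨⟨hz, h0, h1, h3, h4⟩, hfl⟩ := hρ
  rw [← hsdef] at h3 h4
  have hD0 : 0 ≤ min |ρ.im - T| |ρ.im - 2 * T| := le_min (abs_nonneg _) (abs_nonneg _)
  obtain ⟨hjD, hDj⟩ := (Nat.floor_eq_iff hD0).1 hfl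
  have h0₁ : (0 : ℝ) ≤ T + j - 1 := by linarith
  have h0₂ : (0 : ℝ) ≤ max (T - j - 2) (T - s - 3) := le_max_of_le_right (by linarith)
  have h0₃ : (0 : ℝ) ≤ min (2 * T + j - 1) (2 * T + s) := le_min (by linarith) (by linarith)
  have h0₄ : (0 : ℝ) ≤ max (2 * T - j - 2) (T - s - 3) := le_max_of_le_right (by linarith)
  simp only [Finset.mem_union, SchoenfeldBound.mem_zerosBetween h0₁, SchoenfeldBound.mem_zerosBetween h0₂,
    SchoenfeldBound.mem_zerosBetween h0₃, SchoenfeldBound.mem_zerosBetween h0₄]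
  rcases le_total |ρ.im - T| |ρ.im - 2 * T| with hmn | hmn
  · rw [min_eq_left hmn] at hjD hDj
    rcases le_or_gt T ρ.im with hle | hlt
    · rw [abs_of_nonneg (by linarith)] at hjD hDj
      exact Or.inl (Or.inl (Or.inl ⟨hz, h0, h1, by linarith, by linarith⟩))
    · rw [abs_of_neg (by linarith)] at hjD hDj
      refine Or.inl (Or.inl (Or.inr ⟨hz, h0, h1, max_lt (by linarith) (by linarith), ?_⟩))
      linarith [le_max_left (T - j - 2) (T - s - 3)]
  · rw [min_eq_right hmn] at hjD hDj
    rcases le_or_gt (2 * T) ρ.im with hle | hlt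
    · rw [abs_of_nonneg (by linarith)] at hjD hDj
      refine Or.inl (Or.inr ⟨hz, h0, h1, lt_of_le_of_lt (min_le_left _ _) (by linarith), ?_⟩)
      linarith [le_min (show ρ.im ≤ 2 * T + j - 1 + 2 by linarith) (show ρ.im ≤ 2 * T + s + 2 by linarith),
        min_add_add_right (2 * T + j - 1) (2 * T + s) 2]
    · rw [abs_of_neg (by linarith)] at hjD hDj
      refine Or.inr ⟨hz, h0, h1, max_lt (by linarith) (by linarith), ?_⟩
      linarith [le_max_left (2 * T - j - 2) (T - s - 3)]

/-- **Far zeros: `Σ_{D_ρ ≥ 2} m_ρ/D_ρ ≤ 180 L²`** (`T ≥ 300`, `L ≥ 10`): group by the layer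
`⌊D_ρ⌋ = j ∈ [1, 2T]`, each of mass `≤ 120 L`, against the harmonic sum `Σ_{j ≤ 2T} 1/j ≤ 1 + log 2T`.
[cite: AlpogeFurman2026, Proposition 4.2 (proof: "summing `min(1, ‖L(x−T)‖^{-100})` against the
density `≪ L`"), p. 6] -/
theorem sum_far_div_le {T : ℝ} (hT : 300 ≤ T) (hL : 10 ≤ logHeight T) :
    ∑ ρ ∈ (nearZeroFinset T).filter (fun ρ ↦ ¬min |ρ.im - T| |ρ.im - 2 * T| < 2),
      (riemannZetaZeroOrder ρ : ℝ) / min |ρ.im - T| |ρ.im - 2 * T| ≤ 180 * logHeight T ^ 2 := by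
  classical
  have hπ := Real.pi_gt_three
  obtain ⟨hs17, hsle⟩ := sqrt_facts hT
  have hT0 : 0 < T := by linarith
  have hT1 : (1 : ℝ) < T := by linarith
  set L := logHeight T with hLdef
  set S' := (nearZeroFinset T).filter (fun ρ ↦ ¬min |ρ.im - T| |ρ.im - 2 * T| < 2) with hS'
  set n : ℂ → ℕ := fun ρ ↦ ⌊min |ρ.im - T| |ρ.im - 2 * T|⌋₊ with hndef
  set N := ⌊2 * T⌋₊ with hNdef
  have hmem : ∀ ρ ∈ S', ρ ∈ nearZeros T ∧ 2 ≤ min |ρ.im - T| |ρ.im - 2 * T| := by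
    intro ρ hρ
    rw [hS', Finset.mem_filter, mem_nearZeroFinset, not_lt] at hρ
    exact hρ
  have hnD : ∀ ρ ∈ S', (n ρ : ℝ) ≤ min |ρ.im - T| |ρ.im - 2 * T| := fun ρ hρ ↦
    Nat.floor_le (by linarith [(hmem ρ hρ).2])
  have hn2 : ∀ ρ ∈ S', 2 ≤ n ρ := fun ρ hρ ↦ Nat.le_floor (by exact_mod_cast (hmem ρ hρ).2)
  have hmaps : ∀ ρ ∈ S', n ρ ∈ Finset.Icc 1 N := by
    intro ρ hρ
    rw [Finset.mem_Icc]
    refine ⟨le_trans (by norm_num) (hn2 ρ hρ), Nat.le_floor ((hnD ρ hρ).trans ?_)⟩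
    obtain ⟨⟨-, -, -, h3, h4⟩, -⟩ := hmem ρ hρ
    refine (min_le_left _ _).trans (abs_le.2 ⟨by linarith, by linarith⟩)
  have hm0 : ∀ ρ ∈ S', (0 : ℝ) ≤ riemannZetaZeroOrder ρ := fun ρ hρ ↦ by
    exact_mod_cast (riemannZetaZeroOrder_pos_of_mem_nearZeros hT1 (hmem ρ hρ).1).le
  -- `m/D ≤ m/⌊D⌋`
  have step1 : ∑ ρ ∈ S', (riemannZetaZeroOrder ρ : ℝ) / min |ρ.im - T| |ρ.im - 2 * T| ≤
      ∑ ρ ∈ S', (riemannZetaZeroOrder ρ : ℝ) / n ρ := by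
    refine Finset.sum_le_sum fun ρ hρ ↦ ?_
    have : (0 : ℝ) < n ρ := by have := hn2 ρ hρ; positivity
    exact div_le_div_of_nonneg_left (hm0 ρ hρ) this (hnD ρ hρ)
  -- group by layers
  have step2 : ∑ ρ ∈ S', (riemannZetaZeroOrder ρ : ℝ) / n ρ =
      ∑ j ∈ Finset.Icc 1 N, ∑ ρ ∈ S'.filter (fun ρ ↦ n ρ = j), (riemannZetaZeroOrder ρ : ℝ) / n ρ :=
    (Finset.sum_fiberwise_of_maps_to hmaps _).symm
  have step3 : ∀ j ∈ Finset.Icc 1 N,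
      ∑ ρ ∈ S'.filter (fun ρ ↦ n ρ = j), (riemannZetaZeroOrder ρ : ℝ) / n ρ ≤ 120 * L / j := by
    intro j hj
    rw [Finset.mem_Icc] at hj
    have hjT : (j : ℝ) ≤ 2 * T := (Nat.cast_le.2 hj.2).trans (Nat.floor_le (by linarith))
    have hj0 : (0 : ℝ) < j := by exact_mod_cast hj.1
    have e : ∑ ρ ∈ S'.filter (fun ρ ↦ n ρ = j), (riemannZetaZeroOrder ρ : ℝ) / n ρ =
        (∑ ρ ∈ S'.filter (fun ρ ↦ n ρ = j), (riemannZetaZeroOrder ρ : ℝ)) / j := by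
      rw [Finset.sum_div]
      refine Finset.sum_congr rfl fun ρ hρ ↦ ?_
      rw [(Finset.mem_filter.1 hρ).2]
    rw [e, div_le_div_iff_of_pos_right hj0]
    have hsub : S'.filter (fun ρ ↦ n ρ = j) ⊆
        (nearZeroFinset T).filter (fun ρ ↦ ⌊min |ρ.im - T| |ρ.im - 2 * T|⌋₊ = j) := by
      intro ρ hρ
      rw [Finset.mem_filter] at hρ ⊢
      exact ⟨Finset.filter_subset _ _ hρ.1, hρ.2⟩
    refine (Finset.sum_le_sum_of_subset_of_nonneg hsub fun ρ hρ _ ↦ ?_).trans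
      (sum_layer_le hT hL hj.1 hjT)
    exact_mod_cast (riemannZetaZeroOrder_pos_of_mem_nearZeros hT1
      (mem_nearZeroFinset.1 (Finset.filter_subset _ _ hρ))).le
  -- the harmonic sum
  have step4 : ∑ j ∈ Finset.Icc 1 N, (120 * L / j : ℝ) ≤ 120 * L * (1 + Real.log N) := by
    have e : ∑ j ∈ Finset.Icc 1 N, (120 * L / j : ℝ) = 120 * L * (harmonic N : ℝ) := by
      rw [harmonic_eq_sum_Icc, Rat.cast_sum, Finset.mul_sum]
      refine Finset.sum_congr rfl fun j _ ↦ ?_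
      rw [Rat.cast_inv, Rat.cast_natCast, div_eq_mul_inv]
    rw [e]
    exact mul_le_mul_of_nonneg_left (harmonic_le_one_add_log N) (by linarith)
  have hN1 : (1 : ℝ) ≤ N := by
    have : (1 : ℕ) ≤ N := Nat.le_floor (by norm_num; linarith)
    exact_mod_cast this
  have hlogN : Real.log N ≤ L + 4 := by
    have hNle : (N : ℝ) ≤ 2 * T := Nat.floor_le (by linarith)
    calc Real.log N ≤ Real.log (2 * T) := Real.log_le_log (by linarith) hNle
      _ = Real.log 2 + Real.log T := Real.log_mul (by norm_num) hT0.ne'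
      _ ≤ L + 4 := by rw [log_eq_logHeight_add hT0]; linarith [log_two_pi_le_two', Real.log_two_lt_d9]
  calc ∑ ρ ∈ S', (riemannZetaZeroOrder ρ : ℝ) / min |ρ.im - T| |ρ.im - 2 * T|
      ≤ ∑ j ∈ Finset.Icc 1 N, ∑ ρ ∈ S'.filter (fun ρ ↦ n ρ = j), (riemannZetaZeroOrder ρ : ℝ) / n ρ := by
        rw [← step2]; exact step1
    _ ≤ ∑ j ∈ Finset.Icc 1 N, (120 * L / j : ℝ) := Finset.sum_le_sum step3
    _ ≤ 120 * L * (1 + Real.log N) := step4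
    _ ≤ 120 * L * (L + 5) := mul_le_mul_of_nonneg_left (by linarith) (by linarith)
    _ ≤ 180 * L ^ 2 := by nlinarith

/-- The zeros of the window outside `(T, 2T]` have mass `≤ 150 √T L` (`T ≥ 300`; restated from
`nearZeroCount_sub_window_le`). [cite: AlpogeFurman2026, §6 (p. 12)] -/
theorem sum_outside_le {T : ℝ} (hT : 300 ≤ T) :
    ∑ ρ ∈ (nearZeroFinset T).filter (fun ρ ↦ ¬(T < ρ.im ∧ ρ.im ≤ 2 * T)),
      (riemannZetaZeroOrder ρ : ℝ) ≤ 150 * Real.sqrt T * logHeight T := by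
  have h := nearZeroCount_sub_window_le hT
  rw [nearZeroCount_eq_window_add (by linarith : (1 : ℝ) < T), add_sub_cancel_left] at h
  exact h


/-! ## §8. Assembly: Proposition 4.2 -/

/-- The layer coefficients: for `D ≥ 2`, `L ≥ 10`, `0 ≤ a ≤ 5`, `0 ≤ b ≤ 3`,
`a/D² + b/(hD) ≤ L/D` (`h = 2π/L`). [folklore] -/
private theorem layer_coeff_le {L D a b : ℝ} (hL : 10 ≤ L) (hD : 2 ≤ D) (ha : 0 ≤ a) (ha5 : a ≤ 5)
    (hb0 : 0 ≤ b) (hb : b ≤ 3) : a / D ^ 2 + b / (2 * π / L * D) ≤ L / D := by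
  have hπ := Real.pi_gt_three
  have hD0 : 0 < D := by linarith
  have hL0 : 0 < L := by linarith
  have h1 : a / D ^ 2 ≤ (a / 2) / D := by
    rw [div_le_div_iff₀ (by positivity) hD0]
    nlinarith [mul_nonneg ha (by linarith : 0 ≤ D - 2)]
  have h2 : b / (2 * π / L * D) ≤ (b * L / 6) / D := by
    rw [show 2 * π / L * D = 2 * π * D / L by ring, div_div_eq_mul_div,
      div_le_div_iff₀ (by positivity) hD0]
    nlinarith [mul_nonneg (mul_nonneg hb0 hL0.le) hD0.le]
  have h3 : (a / 2) / D + (b * L / 6) / D ≤ L / D := by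
    rw [← add_div]
    exact div_le_div_of_nonneg_right (by nlinarith) hD0.le
  linarith

/-- **Uniform per-zero bound.** For a zero `ρ` of the window (`T ≥ 300`, `L ≥ 10`), with
`D_ρ = min(|γ−T|, |γ−2T|)` and `M = L∫φ²`:
`|E_ρ| ≤ [D_ρ < 2] (√T + 1) M + [D_ρ ≥ 2] C_d² √T L/D_ρ + [γ ∉ (T,2T]] M`.
[cite: AlpogeFurman2026, Proposition 4.2 (proof), p. 6] -/
theorem norm_E_le (hψ : IsWindow ψ) {B K Kχ : ℝ} (hB0 : 0 ≤ B) (hK0 : 0 ≤ K) (hKχ0 : 0 ≤ Kχ)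
    (hB : ∀ x ∈ Icc (-(1 / 2 : ℝ)) (1 / 2), Real.sqrt (ψ x) ≤ B)
    (hK : ∀ a ∈ Icc (-(1 / 2 : ℝ)) (1 / 2), ∀ b ∈ Icc (-(1 / 2 : ℝ)) (1 / 2),
      |Real.sqrt (ψ a) - Real.sqrt (ψ b)| ≤ K * |a - b|)
    (hKχ : ∀ a b : ℝ, |smoothRamp a - smoothRamp b| ≤ Kχ * |a - b|)
    {T : ℝ} (hT : 300 ≤ T) (hL : 10 ≤ logHeight T) {ρ : ℂ} (hρ : ρ ∈ nearZeros T) :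
    ‖∑ k : Fin (gridDim T), hat (fun u ↦ (phi ψ T u : ℂ))
          (gammaOf ρ - grid T (logHeight T) ((k : ℕ) : ℤ)) ^ 2 -
        ((logHeight T * ∫ u : ℝ, phi ψ T u ^ 2 : ℝ) : ℂ)‖ ≤
      (if min |ρ.im - T| |ρ.im - 2 * T| < 2 then
          (Real.sqrt T + 1) * (logHeight T * ∫ u : ℝ, phi ψ T u ^ 2)
        else (π / 2 * Real.exp (π / 2) * (B + K + 4 * (1 + π) * Kχ * B)) ^ 2 * Real.sqrt T *
          logHeight T / min |ρ.im - T| |ρ.im - 2 * T|) +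
      (if T < ρ.im ∧ ρ.im ≤ 2 * T then 0 else logHeight T * ∫ u : ℝ, phi ψ T u ^ 2) := by
  have hπ := Real.pi_gt_three
  have hT0 : 0 < T := by linarith
  have hT1 : (1 : ℝ) < T := by linarith
  set L := logHeight T with hLdef
  set M := L * ∫ u : ℝ, phi ψ T u ^ 2 with hMdef
  set Cd := π / 2 * Real.exp (π / 2) * (B + K + 4 * (1 + π) * Kχ * B) with hCd
  set z := gammaOf ρ with hzdef
  have hzre : z.re = ρ.im := (gammaOf_re_im ρ).1
  have hzim : z.im = 1 / 2 - ρ.re := (gammaOf_re_im ρ).2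
  obtain ⟨hre0, hre1⟩ := re_mem_Ioo_of_mem_nearZeros hT1 hρ
  have hy : |z.im| ≤ 1 / 2 := by rw [hzim, abs_le]; constructor <;> linarith
  have hL0 : 0 < L := by linarith
  have hM0 : 0 ≤ M := mul_nonneg hL0.le (integral_nonneg fun u ↦ sq_nonneg _)
  -- `e^{L|y|} ≤ e^{L/2} = √(T/2π) ≤ √T`
  have hexp : Real.exp (L * |z.im|) ≤ Real.sqrt T := by
    have h1 : Real.exp (L * |z.im|) ≤ Real.exp (L / 2) :=
      Real.exp_le_exp.2 (by nlinarith [abs_nonneg z.im])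
    have h2 : Real.exp (L / 2) ^ 2 ≤ T := by
      rw [pow_two, ← Real.exp_add, add_halves, hLdef, logHeight, Real.exp_log (by positivity)]
      exact div_le_self hT0.le (by linarith)
    calc Real.exp (L * |z.im|) ≤ Real.exp (L / 2) := h1
      _ = Real.sqrt (Real.exp (L / 2) ^ 2) := (Real.sqrt_sq (Real.exp_pos _).le).symm
      _ ≤ Real.sqrt T := Real.sqrt_le_sqrt h2
  have hW : Cd ^ 2 * Real.exp (L * |z.im|) ≤ Cd ^ 2 * Real.sqrt T :=
    mul_le_mul_of_nonneg_left hexp (sq_nonneg _)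
  have hI0 : 0 ≤ (if T < ρ.im ∧ ρ.im ≤ 2 * T then 0 else M) := by split_ifs <;> linarith
  by_cases hnear : min |ρ.im - T| |ρ.im - 2 * T| < 2
  · rw [if_pos hnear]
    have h : ‖∑ k : Fin (gridDim T), hat (fun u ↦ (phi ψ T u : ℂ))
          (z - grid T L ((k : ℕ) : ℤ)) ^ 2 - ((M : ℝ) : ℂ)‖ ≤ (Real.exp (L * |z.im|) + 1) * M :=
      norm_sum_sq_hat_sub_le_near hψ hL0 z
    calc _ ≤ (Real.exp (L * |z.im|) + 1) * M := h
      _ ≤ (Real.sqrt T + 1) * M := mul_le_mul_of_nonneg_right (by linarith) hM0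
      _ ≤ _ := le_add_of_nonneg_right hI0
  · rw [if_neg hnear]
    rw [not_lt] at hnear
    set D := min |ρ.im - T| |ρ.im - 2 * T| with hDdef
    have hD0 : 0 < D := by linarith
    have hD1 : 1 ≤ D := by linarith
    have hDl : D ≤ |ρ.im - T| := min_le_left _ _
    have hDr : D ≤ |ρ.im - 2 * T| := min_le_right _ _
    by_cases hin : T < ρ.im ∧ ρ.im ≤ 2 * T
    · rw [if_pos hin, add_zero]
      have hx1 : T + D ≤ z.re := by
        rw [abs_of_nonneg (by linarith [hin.1])] at hDl; rw [hzre]; linarith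
      have hx2 : z.re + D ≤ 2 * T := by
        rw [abs_of_nonpos (by linarith [hin.2])] at hDr; rw [hzre]; linarith
      have h : ‖∑ k : Fin (gridDim T), hat (fun u ↦ (phi ψ T u : ℂ))
            (z - grid T L ((k : ℕ) : ℤ)) ^ 2 - ((M : ℝ) : ℂ)‖ ≤
          Cd ^ 2 * Real.exp (L * |z.im|) * (5 / D ^ 2 + 3 / (2 * π / L * D)) :=
        norm_sum_sq_hat_sub_le_inside hψ hB0 hK0 hKχ0 hB hK hKχ hT0 hL hy hnear hx1 hx2
      calc _ ≤ Cd ^ 2 * Real.exp (L * |z.im|) * (5 / D ^ 2 + 3 / (2 * π / L * D)) := h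
        _ ≤ Cd ^ 2 * Real.sqrt T * (L / D) :=
          mul_le_mul hW (layer_coeff_le hL hnear (by norm_num) le_rfl (by norm_num) le_rfl)
            (by positivity) (by positivity)
        _ = Cd ^ 2 * Real.sqrt T * L / D := by ring
    · rw [if_neg hin]
      rcases not_and_or.1 hin with hxl | hxr
      · have hx : z.re + D ≤ T := by
          rw [abs_of_nonpos (by linarith [not_lt.1 hxl])] at hDl; rw [hzre]; linarith
        have h : ‖∑ k : Fin (gridDim T), hat (fun u ↦ (phi ψ T u : ℂ))
              (z - grid T L ((k : ℕ) : ℤ)) ^ 2 - ((M : ℝ) : ℂ)‖ ≤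
            Cd ^ 2 * Real.exp (L * |z.im|) * (1 / D ^ 2 + 1 / (2 * π / L * D)) + M :=
          norm_sum_sq_hat_sub_le_left hψ hB0 hK0 hKχ0 hB hK hKχ hL hy hD1 hx
        calc _ ≤ Cd ^ 2 * Real.exp (L * |z.im|) * (1 / D ^ 2 + 1 / (2 * π / L * D)) + M := h
          _ ≤ Cd ^ 2 * Real.sqrt T * (L / D) + M :=
            add_le_add (mul_le_mul hW (layer_coeff_le (a := 1) (b := 1) hL hnear (by norm_num)
              (by norm_num) (by norm_num) (by norm_num)) (by positivity) (by positivity)) le_rfl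
          _ = Cd ^ 2 * Real.sqrt T * L / D + M := by ring
      · have hx : 2 * T + D ≤ z.re := by
          rw [abs_of_nonneg (by linarith [not_le.1 hxr])] at hDr; rw [hzre]; linarith
        have h : ‖∑ k : Fin (gridDim T), hat (fun u ↦ (phi ψ T u : ℂ))
              (z - grid T L ((k : ℕ) : ℤ)) ^ 2 - ((M : ℝ) : ℂ)‖ ≤
            Cd ^ 2 * Real.exp (L * |z.im|) * (1 / D ^ 2 + 1 / (2 * π / L * D)) + M :=
          norm_sum_sq_hat_sub_le_right hψ hB0 hK0 hKχ0 hB hK hKχ hT0 hL hy hD1 hx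
        calc _ ≤ Cd ^ 2 * Real.exp (L * |z.im|) * (1 / D ^ 2 + 1 / (2 * π / L * D)) + M := h
          _ ≤ Cd ^ 2 * Real.sqrt T * (L / D) + M :=
            add_le_add (mul_le_mul hW (layer_coeff_le (a := 1) (b := 1) hL hnear (by norm_num)
              (by norm_num) (by norm_num) (by norm_num)) (by positivity) (by positivity)) le_rfl
          _ = Cd ^ 2 * Real.sqrt T * L / D + M := by ring

end AlpogeFurman2026

open AlpogeFurman2026 in
/-- **[AF26] Proposition 4.2, proved: `tr G̃ = N(I′) + O(√X L²)`.** For every window `ψ` there are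
`C, T₀` with `|tr G̃ − N(I′)| ≤ C √T L²` for all `T ≥ T₀` — the tree's claim `AlpogeFurman2026_trace`
DISCHARGED (in fact with `√T L` in place of `√T L²`, absorbed using `L ≥ 1`). Assembly of §§1–8:
`tr G̃ − N(I′) = M⁻¹ Σ_ρ m_ρ E_ρ` (`trace_gramMatrix_eq`), the per-zero bound `norm_E_le`, the near
mass `≤ 120 L` (`sum_near_le`), the far layers `Σ m_ρ/D_ρ ≤ 180 L²` (`sum_far_div_le`), the outside
mass `≤ 150 √T L` (`sum_outside_le`) and `M ≥ m₀L²/2` (`normalisation_ge`); here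
`T₀ = max(300, 2π e^{10})` and `C = 390 + 360 C_d²/m₀` with `C_d` the decay constant of
`norm_hat_phi_le` and `m₀ = min ψ`. RH-FREE. [cite: AlpogeFurman2026, Proposition 4.2, p. 6] -/
theorem AlpogeFurman2026_trace_holds : AlpogeFurman2026_trace := by
  classical
  intro ψ hψ
  have hπ := Real.pi_gt_three
  obtain ⟨m₀, B, K, hm₀, hB0, hK0, hfloor, hB, hK⟩ := hψ.exists_bounds
  obtain ⟨Kχ, hKχ0, hKχ⟩ := exists_lipschitz_smoothRamp
  set Cd := π / 2 * Real.exp (π / 2) * (B + K + 4 * (1 + π) * Kχ * B) with hCd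
  refine ⟨390 + 360 * Cd ^ 2 / m₀, max 300 (2 * π * Real.exp 10), fun T hT ↦ ?_⟩
  obtain ⟨hT300, hTe⟩ := max_le_iff.1 hT
  have hT0 : 0 < T := by linarith
  have hT1 : (1 : ℝ) < T := by linarith
  set L := logHeight T with hLdef
  have hL : 10 ≤ L := by
    rw [hLdef, logHeight, Real.le_log_iff_exp_le (by positivity), le_div_iff₀ (by positivity)]
    linarith
  have hL0 : 0 < L := by linarith
  have hL1 : 1 ≤ L := by linarith
  set M := L * ∫ u : ℝ, phi ψ T u ^ 2 with hMdef
  have hMge : m₀ * L ^ 2 / 2 ≤ M := normalisation_ge hψ hm₀ hfloor (by linarith)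
  have hM0 : 0 < M := lt_of_lt_of_le (by positivity) hMge
  set s := Real.sqrt T with hsdef
  obtain ⟨hs17, -⟩ := AlpogeFurman2026.sqrt_facts hT300
  have hs1 : 1 ≤ s := by linarith
  -- the final scalar arithmetic (done first, in a small context)
  have t1 : M⁻¹ * ((s + 1) * M * (120 * L)) = 120 * L * (s + 1) := by
    rw [inv_mul_eq_iff_eq_mul₀ hM0.ne']
    ring
  have t3 : M⁻¹ * (M * (150 * s * L)) = 150 * s * L := inv_mul_cancel_left₀ hM0.ne' _
  have t2 : M⁻¹ * (Cd ^ 2 * s * L * (180 * L ^ 2)) ≤ 360 * Cd ^ 2 / m₀ * s * L := by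
    rw [inv_mul_le_iff₀ hM0]
    have h := mul_le_mul_of_nonneg_right hMge
      (show 0 ≤ 360 * Cd ^ 2 / m₀ * s * L by positivity)
    have e : m₀ * L ^ 2 / 2 * (360 * Cd ^ 2 / m₀ * s * L) = Cd ^ 2 * s * L * (180 * L ^ 2) := by
      field_simp
      ring
    linarith [h, e]
  have u1 : L ≤ L ^ 2 := by nlinarith
  have u2 : 120 * L * (s + 1) ≤ 240 * s * L ^ 2 := by
    have : (s + 1) * L ≤ 2 * s * L ^ 2 := mul_le_mul (by linarith) u1 (by linarith) (by linarith)
    linarith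
  have u3 : 150 * s * L ≤ 150 * s * L ^ 2 := by
    have := mul_le_mul_of_nonneg_left u1 (show 0 ≤ 150 * s by linarith)
    linarith
  have u4 : 360 * Cd ^ 2 / m₀ * s * L ≤ 360 * Cd ^ 2 / m₀ * s * L ^ 2 := by
    have := mul_le_mul_of_nonneg_left u1 (show 0 ≤ 360 * Cd ^ 2 / m₀ * s by positivity)
    linarith
  have fin : M⁻¹ * ((s + 1) * M * (120 * L) + Cd ^ 2 * s * L * (180 * L ^ 2) + M * (150 * s * L)) ≤
      (390 + 360 * Cd ^ 2 / m₀) * s * L ^ 2 := by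
    have e : M⁻¹ * ((s + 1) * M * (120 * L) + Cd ^ 2 * s * L * (180 * L ^ 2) + M * (150 * s * L)) =
        M⁻¹ * ((s + 1) * M * (120 * L)) + M⁻¹ * (Cd ^ 2 * s * L * (180 * L ^ 2)) +
          M⁻¹ * (M * (150 * s * L)) := by ring
    rw [e, t1, t3]
    have e2 : (390 + 360 * Cd ^ 2 / m₀) * s * L ^ 2 =
        240 * s * L ^ 2 + 360 * Cd ^ 2 / m₀ * s * L ^ 2 + 150 * s * L ^ 2 := by ring
    rw [e2]
    linarith
  -- the error terms `E_ρ`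
  set E : ℂ → ℂ := fun ρ ↦ ∑ k : Fin (gridDim T), hat (fun u ↦ (phi ψ T u : ℂ))
      (gammaOf ρ - grid T L ((k : ℕ) : ℤ)) ^ 2 - ((M : ℝ) : ℂ) with hEdef
  have hm0 : ∀ ρ ∈ nearZeroFinset T, (0 : ℝ) < riemannZetaZeroOrder ρ := fun ρ hρ ↦ by
    exact_mod_cast riemannZetaZeroOrder_pos_of_mem_nearZeros hT1 (mem_nearZeroFinset.1 hρ)
  -- the trace identity `tr G̃ − N(I′) = M⁻¹ Σ m_ρ E_ρ`
  have hN : (nearZeroCount T : ℂ) = ∑ ρ ∈ nearZeroFinset T, (riemannZetaZeroOrder ρ : ℂ) := by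
    have h := congrArg (Int.cast : ℤ → ℂ) (nearZeroCount_eq_sum hT1)
    push_cast at h
    exact h
  have hMC : ((M : ℝ) : ℂ) ≠ 0 := Complex.ofReal_ne_zero.2 hM0.ne'
  have hid : (gramMatrix ψ T).trace - (nearZeroCount T : ℂ) =
      ((M : ℝ) : ℂ)⁻¹ * ∑ ρ ∈ nearZeroFinset T, (riemannZetaZeroOrder ρ : ℂ) * E ρ := by
    have ht : (gramMatrix ψ T).trace = ((M : ℝ) : ℂ)⁻¹ *
        ∑ ρ ∈ nearZeroFinset T, (riemannZetaZeroOrder ρ : ℂ) *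
          ∑ k : Fin (gridDim T), hat (fun u ↦ (phi ψ T u : ℂ)) (gammaOf ρ - grid T L ((k : ℕ) : ℤ)) ^ 2 := by
      rw [trace_gramMatrix_eq, gramWeight_eq_inv ψ (T := T) hL0.ne']
    rw [ht, hN, Finset.mul_sum, Finset.mul_sum, ← Finset.sum_sub_distrib]
    refine Finset.sum_congr rfl fun ρ _ ↦ ?_
    rw [hEdef]
    dsimp only
    rw [mul_sub, mul_sub, mul_comm (riemannZetaZeroOrder ρ : ℂ) ((M : ℝ) : ℂ), inv_mul_cancel_left₀ hMC]
  -- per-zero bounds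
  have hE : ∀ ρ ∈ nearZeroFinset T, ‖E ρ‖ ≤
      (if min |ρ.im - T| |ρ.im - 2 * T| < 2 then (s + 1) * M
        else Cd ^ 2 * s * L / min |ρ.im - T| |ρ.im - 2 * T|) +
      (if T < ρ.im ∧ ρ.im ≤ 2 * T then 0 else M) := fun ρ hρ ↦
    norm_E_le hψ hB0 hK0 hKχ0 hB hK hKχ hT300 hL (mem_nearZeroFinset.1 hρ)
  -- the norm of the sum
  have hnorm : ‖(gramMatrix ψ T).trace - (nearZeroCount T : ℂ)‖ ≤
      M⁻¹ * ∑ ρ ∈ nearZeroFinset T, (riemannZetaZeroOrder ρ : ℝ) * ‖E ρ‖ := by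
    rw [hid, norm_mul, norm_inv, Complex.norm_real, Real.norm_of_nonneg hM0.le]
    refine mul_le_mul_of_nonneg_left ((norm_sum_le _ _).trans (Finset.sum_le_sum fun ρ hρ ↦ ?_))
      (inv_nonneg.2 hM0.le)
    rw [norm_mul, Complex.norm_intCast, abs_of_pos (hm0 ρ hρ)]
  -- the three zero sums
  have h1 : ∑ ρ ∈ nearZeroFinset T, (riemannZetaZeroOrder ρ : ℝ) *
      (if min |ρ.im - T| |ρ.im - 2 * T| < 2 then (s + 1) * M
        else Cd ^ 2 * s * L / min |ρ.im - T| |ρ.im - 2 * T|) ≤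
      (s + 1) * M * (120 * L) + Cd ^ 2 * s * L * (180 * L ^ 2) := by
    simp_rw [mul_ite]
    rw [Finset.sum_ite]
    refine add_le_add ?_ ?_
    · rw [← Finset.sum_mul, mul_comm]
      exact mul_le_mul_of_nonneg_left (sum_near_le hT300 hL) (by positivity)
    · have e : ∑ ρ ∈ (nearZeroFinset T).filter (fun ρ ↦ ¬min |ρ.im - T| |ρ.im - 2 * T| < 2),
          (riemannZetaZeroOrder ρ : ℝ) * (Cd ^ 2 * s * L / min |ρ.im - T| |ρ.im - 2 * T|) =
          Cd ^ 2 * s * L * ∑ ρ ∈ (nearZeroFinset T).filter (fun ρ ↦ ¬min |ρ.im - T| |ρ.im - 2 * T| < 2),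
            (riemannZetaZeroOrder ρ : ℝ) / min |ρ.im - T| |ρ.im - 2 * T| := by
        rw [Finset.mul_sum]
        refine Finset.sum_congr rfl fun ρ _ ↦ ?_
        ring
      rw [e]
      exact mul_le_mul_of_nonneg_left (sum_far_div_le hT300 hL) (by positivity)
  have h2 : ∑ ρ ∈ nearZeroFinset T, (riemannZetaZeroOrder ρ : ℝ) *
      (if T < ρ.im ∧ ρ.im ≤ 2 * T then 0 else M) ≤ M * (150 * s * L) := by
    simp_rw [mul_ite, mul_zero]
    rw [Finset.sum_ite, Finset.sum_const_zero, zero_add, ← Finset.sum_mul, mul_comm]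
    exact mul_le_mul_of_nonneg_left (sum_outside_le hT300) hM0.le
  have hsum : ∑ ρ ∈ nearZeroFinset T, (riemannZetaZeroOrder ρ : ℝ) * ‖E ρ‖ ≤
      (s + 1) * M * (120 * L) + Cd ^ 2 * s * L * (180 * L ^ 2) + M * (150 * s * L) := by
    calc ∑ ρ ∈ nearZeroFinset T, (riemannZetaZeroOrder ρ : ℝ) * ‖E ρ‖
        ≤ ∑ ρ ∈ nearZeroFinset T, (riemannZetaZeroOrder ρ : ℝ) *
            ((if min |ρ.im - T| |ρ.im - 2 * T| < 2 then (s + 1) * M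
              else Cd ^ 2 * s * L / min |ρ.im - T| |ρ.im - 2 * T|) +
            (if T < ρ.im ∧ ρ.im ≤ 2 * T then 0 else M)) :=
          Finset.sum_le_sum fun ρ hρ ↦ mul_le_mul_of_nonneg_left (hE ρ hρ) (hm0 ρ hρ).le
      _ = _ + _ := by rw [← Finset.sum_add_distrib]; simp_rw [mul_add]
      _ ≤ _ := add_le_add h1 h2
  -- conclusion
  calc ‖(gramMatrix ψ T).trace - (nearZeroCount T : ℂ)‖
      ≤ M⁻¹ * ∑ ρ ∈ nearZeroFinset T, (riemannZetaZeroOrder ρ : ℝ) * ‖E ρ‖ := hnorm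
    _ ≤ M⁻¹ * ((s + 1) * M * (120 * L) + Cd ^ 2 * s * L * (180 * L ^ 2) + M * (150 * s * L)) :=
        mul_le_mul_of_nonneg_left hsum (inv_nonneg.2 hM0.le)
    _ ≤ (390 + 360 * Cd ^ 2 / m₀) * s * L ^ 2 := fin

/-! ## §9. Consequence: [AF26] Theorem A from Theorem 5.7 ALONE

With Proposition 4.2 proved, the §6 assembly of `CriticalLineTwoThirdsMatrixProofs` needs only the
Hilbert–Schmidt evaluation (Theorem 5.7, the claim `AlpogeFurman2026_hilbertSchmidt`). These are
one-line specialisations, recorded so that the dependency is visible in the kernel: in the typed model,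
`AlpogeFurman2026_hilbertSchmidt → Theorem A`. (No endorsement: Theorem 5.7 is the analytic heart of
[AF26] and remains an unrefereed CLAIM.) -/

open AlpogeFurman2026 in
/-- **[AF26] Theorem A, simple zeros, general window — from Theorem 5.7 alone**: for every window `ψ`
and `ε > 0`, eventually `N₀ˢ(T,2T) ≥ (2 − R(ψ) − ε) N(T,2T)`.
[cite: AlpogeFurman2026, Theorem A and §6 (p. 12)] -/
theorem AlpogeFurman2026_thmA_simple_of_HS (h57 : AlpogeFurman2026_hilbertSchmidt) {ψ : ℝ → ℝ}
    (hψ : IsWindow ψ) :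
    ∀ ε : ℝ, 0 < ε → ∀ᶠ T : ℝ in atTop,
      (2 - windowConstant ψ - ε) * ((zetaZeroCount (2 * T) : ℝ) - zetaZeroCount T) ≤
        (simpleCriticalZeroCount (2 * T) : ℝ) - simpleCriticalZeroCount T :=
  AlpogeFurman2026_thmA_simple_of_trace_HS AlpogeFurman2026_trace_holds h57 hψ

open AlpogeFurman2026 in
/-- **[AF26] Theorem A, distinct zeros, general window — from Theorem 5.7 alone**: eventually
`N*(T,2T) ≥ ((3 − R(ψ))/2 − ε) N(T,2T)`. [cite: AlpogeFurman2026, Theorem A and §6 (p. 12)] -/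
theorem AlpogeFurman2026_thmA_distinct_of_HS (h57 : AlpogeFurman2026_hilbertSchmidt) {ψ : ℝ → ℝ}
    (hψ : IsWindow ψ) :
    ∀ ε : ℝ, 0 < ε → ∀ᶠ T : ℝ in atTop,
      ((3 - windowConstant ψ) / 2 - ε) * ((zetaZeroCount (2 * T) : ℝ) - zetaZeroCount T) ≤
        (distinctZeroCount (2 * T) : ℝ) - distinctZeroCount T :=
  AlpogeFurman2026_thmA_distinct_of_trace_HS AlpogeFurman2026_trace_holds h57 hψ

/-- **[AF26] (1.3), simple zeros (`ψ = 1`: `> ⅔ − ε`) — from Theorem 5.7 alone.**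
[cite: AlpogeFurman2026, Theorem A / eq. (1.3) (p. 1)] -/
theorem AlpogeFurman2026_simple_critical_dyadic_of_HS (h57 : AlpogeFurman2026_hilbertSchmidt) :
    AlpogeFurman2026_simple_critical_dyadic :=
  AlpogeFurman2026_simple_critical_dyadic_of_trace_HS AlpogeFurman2026_trace_holds h57

/-- **[AF26] (1.3), distinct zeros (`ψ = 1`: `> ⅚ − ε`) — from Theorem 5.7 alone.**
[cite: AlpogeFurman2026, Theorem A / eq. (1.3) (p. 1)] -/
theorem AlpogeFurman2026_distinct_dyadic_of_HS (h57 : AlpogeFurman2026_hilbertSchmidt) :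
    AlpogeFurman2026_distinct_dyadic :=
  AlpogeFurman2026_distinct_dyadic_of_trace_HS AlpogeFurman2026_trace_holds h57

/-- **[AF26] (1.4), simple zeros with the Montgomery–Taylor window (`> 0.6725`) — from Theorem 5.7
alone.** [cite: AlpogeFurman2026, eq. (1.4) (p. 1)] -/
theorem AlpogeFurman2026_simple_critical_MT_dyadic_of_HS (h57 : AlpogeFurman2026_hilbertSchmidt) :
    AlpogeFurman2026_simple_critical_MT_dyadic :=
  AlpogeFurman2026_simple_critical_MT_dyadic_of_trace_HS AlpogeFurman2026_trace_holds h57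

/-- **[AF26] (1.4), distinct zeros with the Montgomery–Taylor window (`> 0.83625`) — from Theorem 5.7
alone.** [cite: AlpogeFurman2026, eq. (1.4) (p. 1)] -/
theorem AlpogeFurman2026_distinct_MT_dyadic_of_HS (h57 : AlpogeFurman2026_hilbertSchmidt) :
    AlpogeFurman2026_distinct_MT_dyadic :=
  AlpogeFurman2026_distinct_MT_dyadic_of_trace_HS AlpogeFurman2026_trace_holds h57

/-- **[AF26] Theorem A as printed (cumulative densities `≥ ⅔` and `≥ ⅚`) — from Theorem 5.7 alone.**
[cite: AlpogeFurman2026, Theorem A (p. 1)] -/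
theorem AlpogeFurman2026_thmA_cumulative_of_HS (h57 : AlpogeFurman2026_hilbertSchmidt) :
    AlpogeFurman2026_simple_critical ∧ AlpogeFurman2026_distinct :=
  AlpogeFurman2026_thmA_cumulative_of_trace_HS AlpogeFurman2026_trace_holds h57

/-! ## §10. Consequence: [AF26] Remark 6.1 (the rate `O(log log T/log T)`) from Theorem 5.7 ALONE

The §6 chain is exact in this tree (`simple_chain_i_concrete`, `simpleCritical_window_ge`,
`window_le_nearZeroCount`), so feeding it the two claims WITH their typed error terms — `O(√T L²)` for
the trace (Proposition 4.2, proved above) and `O(N/L)` for the Hilbert–Schmidt norm (Theorem 5.7) —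
gives `N₀ˢ(T,2T) ≥ (2 − R(ψ))N − O(√T L² + N/L) = (2 − R(ψ) − O(1/log T))N`, which is the printed
Remark 6.1 ("rate `O(log log T/log T)`", p. 12) with room to spare. Hence the last independent
`ζ`-claim of `CriticalLineTwoThirds.lean`, `AlpogeFurman2026_simple_critical_rate`, is also a
consequence of `AlpogeFurman2026_hilbertSchmidt` in the typed model. (No endorsement; nothing here
bears on the truth of RH.) -/

namespace AlpogeFurman2026

/-- Error term A of the rate bookkeeping: `C N/L ≤ 2C (log l/l) N` when `L ≥ l/2`, `log l ≥ 1`. [folklore] -/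
private theorem rate_errA {C N L l : ℝ} (hC : 0 ≤ C) (hN : 0 ≤ N) (hl : 0 < l)
    (hL : l / 2 ≤ L) (hll : 1 ≤ Real.log l) :
    C * N / L ≤ 2 * C * (Real.log l / l) * N := by
  have h1 : C * N / L ≤ C * N / (l / 2) :=
    div_le_div_of_nonneg_left (by positivity) (by positivity) hL
  have h2 : C * N / (l / 2) = 2 * C * N / l := by field_simp
  have h3 : 2 * C * N / l ≤ 2 * C * N * Real.log l / l := by
    refine div_le_div_of_nonneg_right ?_ hl.le
    have : 0 ≤ 2 * C * N := by positivity
    nlinarith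
  have h4 : 2 * C * N * Real.log l / l = 2 * C * (Real.log l / l) * N := by ring
  linarith [h1, h2.le, h3, h4.le]

/-- Error term B of the rate bookkeeping: `4C√T L² ≤ 32πC (log l/l) N` when `L ≤ l ≤ 2L`,
`l² ≤ √T`, `TL ≤ 4πN`, `log l ≥ 1`. [folklore] -/
private theorem rate_errB {C N L l s T : ℝ} (hC : 0 ≤ C) (hN : 0 ≤ N) (hl : 0 < l) (hLpos : 0 < L)
    (hLle : L ≤ l) (hlL : l ≤ 2 * L) (hs : 0 ≤ s) (hsq : s * s = T) (hlsq : l ^ 2 ≤ s)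
    (hTL : T * L ≤ 4 * π * N) (hll : 1 ≤ Real.log l) :
    4 * C * s * L ^ 2 ≤ 32 * π * C * (Real.log l / l) * N := by
  have hπ := Real.pi_gt_three
  have hT : 0 ≤ T := by rw [← hsq]; positivity
  -- multiply through by `l > 0`
  rw [show 32 * π * C * (Real.log l / l) * N = 32 * π * C * Real.log l * N / l by ring,
    le_div_iff₀ hl]
  have h1 : L ^ 2 ≤ l ^ 2 := pow_le_pow_left₀ hLpos.le hLle 2
  calc 4 * C * s * L ^ 2 * l ≤ 4 * C * s * l ^ 2 * l := by
        have : 0 ≤ 4 * C * s * l := by positivity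
        nlinarith
    _ ≤ 4 * C * s * s * l := by
        have : 0 ≤ 4 * C * s * l := by positivity
        nlinarith
    _ = 4 * C * (T * l) := by rw [← hsq]; ring
    _ ≤ 4 * C * (2 * (T * L)) := by
        refine mul_le_mul_of_nonneg_left ?_ (by positivity)
        nlinarith
    _ ≤ 4 * C * (2 * (4 * π * N)) := by
        refine mul_le_mul_of_nonneg_left ?_ (by positivity)
        linarith
    _ = 32 * π * C * N := by ring
    _ ≤ 32 * π * C * N * Real.log l := by
        have : 0 ≤ 32 * π * C * N := by positivity
        nlinarith
    _ = 32 * π * C * Real.log l * N := by ring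

/-- The §6 chain with explicit error terms: for a window, `T ≥ 300` beyond the thresholds of the two
claims, `N₀ˢ(T,2T) ≥ (2 − R(ψ))N(T,2T) − 4|C₁|√T L² − |C₂|N(T,2T)/L`.
[cite: AlpogeFurman2026, §6 proof of Theorem A and Remark 6.1 (p. 12)] -/
theorem simpleCritical_ge_explicit {ψ : ℝ → ℝ} (hψ : IsWindow ψ) {C₁ C₂ T : ℝ} (hT : 300 ≤ T)
    (h1 : ‖(gramMatrix ψ T).trace - (nearZeroCount T : ℂ)‖ ≤ C₁ * Real.sqrt T * logHeight T ^ 2)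
    (h2 : ‖(gramMatrix ψ T * gramMatrix ψ T).trace -
        (windowConstant ψ : ℂ) * ((zetaZeroCount (2 * T) : ℂ) - zetaZeroCount T)‖ ≤
      C₂ * ((zetaZeroCount (2 * T) : ℝ) - zetaZeroCount T) / logHeight T) :
    (2 - windowConstant ψ) * ((zetaZeroCount (2 * T) : ℝ) - zetaZeroCount T) -
        (4 * |C₁| * Real.sqrt T * logHeight T ^ 2 +
          |C₂| * ((zetaZeroCount (2 * T) : ℝ) - zetaZeroCount T) / logHeight T) ≤
      (simpleCriticalZeroCount (2 * T) : ℝ) - simpleCriticalZeroCount T := by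
  have hπ := Real.pi_gt_three
  have hT0 : 0 < T := by linarith
  have hT1' : (1 : ℝ) < T := by linarith
  set N : ℝ := (zetaZeroCount (2 * T) : ℝ) - zetaZeroCount T with hNdef
  set L : ℝ := logHeight T with hLdef
  have hl4 : 4 ≤ Real.log T := by
    rw [show (4 : ℝ) = Real.log (Real.exp 4) by rw [Real.log_exp]]
    refine Real.log_le_log (Real.exp_pos 4) ?_
    have h : Real.exp 4 = Real.exp 1 * Real.exp 1 * Real.exp 1 * Real.exp 1 := by
      rw [← Real.exp_add, ← Real.exp_add, ← Real.exp_add]; norm_num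
    have := Real.exp_one_lt_d9
    have h0 := Real.exp_pos 1
    rw [h]; nlinarith [mul_pos h0 h0, mul_pos (mul_pos h0 h0) h0]
  have hLeq : Real.log T = L + Real.log (2 * π) := log_eq_logHeight_add hT0
  have hLpos : 0 < L := by linarith [log_two_pi_le_two']
  have hN : T * L / (4 * π) ≤ N := dyadic_count_ge (by linarith)
  have hN0 : 0 ≤ N := le_trans (by positivity) hN
  have hchain := simple_chain_i_concrete hψ hT1' hLpos
  have hcount := simpleCritical_window_ge hT1'
  have hN'N := window_le_nearZeroCount hT1'
  -- Proposition 4.2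
  have htr : (nearZeroCount T : ℝ) - |C₁| * Real.sqrt T * L ^ 2 ≤ ((gramMatrix ψ T).trace).re := by
    have h := (abs_re_le_norm _).trans h1
    rw [Complex.sub_re, Complex.natCast_re, abs_le] at h
    have : C₁ * Real.sqrt T * L ^ 2 ≤ |C₁| * Real.sqrt T * L ^ 2 := by
      have := le_abs_self C₁
      have : 0 ≤ Real.sqrt T * L ^ 2 := by positivity
      nlinarith
    linarith [h.1]
  -- Theorem 5.7
  have hHS : ((gramMatrix ψ T * gramMatrix ψ T).trace).re ≤
      windowConstant ψ * N + |C₂| * N / L := by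
    have h := (abs_re_le_norm _).trans h2
    rw [Complex.sub_re, abs_le] at h
    have e : ((windowConstant ψ : ℂ) * ((zetaZeroCount (2 * T) : ℂ) - zetaZeroCount T)).re =
        windowConstant ψ * N := by
      rw [show ((zetaZeroCount (2 * T) : ℂ) - zetaZeroCount T) = (N : ℂ) by push_cast [hNdef]; ring,
        ← Complex.ofReal_mul, Complex.ofReal_re]
    rw [e] at h
    have : C₂ * N / L ≤ |C₂| * N / L :=
      div_le_div_of_nonneg_right (mul_le_mul_of_nonneg_right (le_abs_self _) hN0) hLpos.le
    linarith [h.2]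
  linarith [hchain, hcount, hN'N, htr, hHS]

end AlpogeFurman2026

open AlpogeFurman2026

/-- **[AF26] Remark 6.1 (rate), general window, ASSEMBLED from Proposition 4.2 and Theorem 5.7**:
for every window `ψ` there are `c, T₀` with
`N₀ˢ(T,2T) ≥ (2 − R(ψ) − c·log log T/log T) N(T,2T)` for all `T ≥ T₀` (the printed "Tracking errors
gives `N₀ˢ(T,2T) ≥ (2 − R(ψ) − c_ψ log log T/log T) N(T,2T)` for `T ≥ T₀(ψ,χ)`"). In the typed model the
two claims carry the errors `O(√T L²)` (trace) and `O(N/L)` (Hilbert–Schmidt) and the §6 chain is exact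
(`simpleCritical_ge_explicit`), so the rate obtained is `O(1/log T) ⊂ O(log log T/log T)`.
[cite: AlpogeFurman2026, Remark 6.1 (p. 12)] -/
theorem AlpogeFurman2026_rate_of_trace_HS (h42 : AlpogeFurman2026_trace)
    (h57 : AlpogeFurman2026_hilbertSchmidt) {ψ : ℝ → ℝ} (hψ : IsWindow ψ) :
    ∃ c T₀ : ℝ, ∀ T : ℝ, T₀ ≤ T →
      (2 - windowConstant ψ - c * Real.log (Real.log T) / Real.log T) *
          ((zetaZeroCount (2 * T) : ℝ) - zetaZeroCount T) ≤
        (simpleCriticalZeroCount (2 * T) : ℝ) - simpleCriticalZeroCount T := by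
  have hπ := Real.pi_gt_three
  obtain ⟨C₁, T₁, h1⟩ := h42 ψ hψ
  obtain ⟨C₂, T₂, h2⟩ := h57 ψ hψ
  refine ⟨32 * π * |C₁| + 2 * |C₂|, ?_⟩
  rw [← Filter.eventually_atTop]
  -- `log T ≤ T^{1/4}` eventually
  have hlo := (isLittleO_log_rpow_atTop (by norm_num : (0 : ℝ) < 1 / 4)).bound one_pos
  -- `log log T ≥ 1` and `log T ≥ 4` eventually
  have hll : ∀ᶠ T : ℝ in atTop, 1 ≤ Real.log (Real.log T) :=
    (Real.tendsto_log_atTop.comp Real.tendsto_log_atTop).eventually (eventually_ge_atTop 1)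
  have hl4 : ∀ᶠ T : ℝ in atTop, 4 ≤ Real.log T :=
    Real.tendsto_log_atTop.eventually (eventually_ge_atTop 4)
  filter_upwards [hlo, hll, hl4, eventually_ge_atTop T₁, eventually_ge_atTop T₂,
    eventually_ge_atTop (300 : ℝ)] with T hT1 hll hl4 hT₁ hT₂ hT300
  have hT0 : 0 < T := by linarith
  have hmain := simpleCritical_ge_explicit hψ hT300 (h1 T hT₁) (h2 T hT₂)
  set N : ℝ := (zetaZeroCount (2 * T) : ℝ) - zetaZeroCount T with hNdef
  set L : ℝ := logHeight T with hLdef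
  set lT : ℝ := Real.log T with hlT
  -- `L` versus `log T`
  have hLeq : lT = L + Real.log (2 * π) := log_eq_logHeight_add hT0
  have hl2π : 0 ≤ Real.log (2 * π) := Real.log_nonneg (by linarith)
  have hLle : L ≤ lT := by linarith
  have hLge : lT / 2 ≤ L := by linarith [log_two_pi_le_two']
  have hlT0 : 0 < lT := by linarith
  have hLpos : 0 < L := by linarith
  have hN : T * L / (4 * π) ≤ N := dyadic_count_ge (by linarith)
  have hN0 : 0 ≤ N := le_trans (by positivity) hN
  have hTL : T * L ≤ 4 * π * N := by
    have h := hN; rw [div_le_iff₀ (by positivity)] at h; linarith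
  -- `log² T ≤ √T`
  have hs0 : 0 ≤ Real.sqrt T := Real.sqrt_nonneg T
  have hsq : Real.sqrt T * Real.sqrt T = T := Real.mul_self_sqrt hT0.le
  have hlogle : lT ≤ T ^ (1 / 4 : ℝ) := by
    have := hT1
    rw [Real.norm_of_nonneg hlT0.le, Real.norm_of_nonneg (Real.rpow_nonneg hT0.le _), one_mul] at this
    exact this
  have h14 : T ^ (1 / 4 : ℝ) * T ^ (1 / 4 : ℝ) = Real.sqrt T := by
    rw [← Real.rpow_add hT0, Real.sqrt_eq_rpow]; norm_num
  have hlsq : lT ^ 2 ≤ Real.sqrt T := by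
    calc lT ^ 2 = lT * lT := sq lT
      _ ≤ T ^ (1 / 4 : ℝ) * T ^ (1 / 4 : ℝ) :=
          mul_le_mul hlogle hlogle hlT0.le (Real.rpow_nonneg hT0.le _)
      _ = Real.sqrt T := h14
  have hA := rate_errA (abs_nonneg C₂) hN0 hlT0 hLge hll
  have hB := rate_errB (abs_nonneg C₁) hN0 hlT0 hLpos hLle (by linarith) hs0 hsq hlsq hTL hll
  have e2 : (2 - windowConstant ψ - (32 * π * |C₁| + 2 * |C₂|) * Real.log lT / lT) * N =
      (2 - windowConstant ψ) * N -
        (32 * π * |C₁| * (Real.log lT / lT) * N + 2 * |C₂| * (Real.log lT / lT) * N) := by ring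
  rw [e2]
  linarith [hmain, hA, hB]

/-- **[AF26] Remark 6.1 for the flat window** (`R(ψ₀) = 4/3`; this is the claim
`AlpogeFurman2026_simple_critical_rate` of `CriticalLineTwoThirds.lean`) **from Proposition 4.2 and
Theorem 5.7.** [cite: AlpogeFurman2026, Remark 6.1 (p. 12)] -/
theorem AlpogeFurman2026_simple_critical_rate_of_trace_HS (h42 : AlpogeFurman2026_trace)
    (h57 : AlpogeFurman2026_hilbertSchmidt) : AlpogeFurman2026_simple_critical_rate := by
  obtain ⟨c, T₀, h⟩ := AlpogeFurman2026_rate_of_trace_HS h42 h57 isWindow_one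
  refine ⟨c, T₀, fun T hT ↦ ?_⟩
  have h' := h T hT
  rw [windowConstant_one] at h'
  have e : (2 : ℝ) - 4 / 3 = 2 / 3 := by norm_num
  rwa [e] at h'

/-- **[AF26] Remark 6.1 (`AlpogeFurman2026_simple_critical_rate`) from Theorem 5.7 ALONE** — so that,
in the typed model, EVERY `ζ`-claim of `CriticalLineTwoThirds.lean` (the four dyadic claims, the two
cumulative ones, and the rate) is a consequence of the single claim `AlpogeFurman2026_hilbertSchmidt`.
[cite: AlpogeFurman2026, Remark 6.1 (p. 12)] -/
theorem AlpogeFurman2026_simple_critical_rate_of_HS (h57 : AlpogeFurman2026_hilbertSchmidt) :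
    AlpogeFurman2026_simple_critical_rate :=
  AlpogeFurman2026_simple_critical_rate_of_trace_HS AlpogeFurman2026_trace_holds h57

end Literature.NumberTheory.LFunctions

end
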